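import Summits.HodgeConjecture.HodgeConjecture.Theses.HeckePrymWeil
import Literature.AlgebraicGeometry.HodgeTheory.ComplexConjugation
import Literature.AlgebraicGeometry.Motives.WeilDiscriminantRealization
import Literature.AlgebraicGeometry.Motives.WeilDiscriminantProduct

/-!
# Disproof of `WeilTwelvefoldsSqrtMinus7` — findings (cdisprove; cycle 1: refuter-cdisprove-stmt-HodgeConjecture-1261-0, cycle 2: refuter-cdisprove-stmt-HodgeConjecture-1261-g2-0, cycle 3: refuter-cdisprove-stmt-HodgeConjecture-1261-g3-0, cycle 4: refuter-cdisprove-stmt-HodgeConjecture-1261-g4-0)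

Crux `stmt-HodgeConjecture-1261` = `Summit.HodgeConjecture.HodgeConjecture.Theses.HeckePrymWeil.WeilTwelvefoldsSqrtMinus7`:
for every complex abelian variety `A` with `A.dim = 12` and `φ : A ⟶ A` with `φ ≫ φ = -(7 • 𝟙 A)`,
every RATIONAL class `c ∈ H¹²(A(ℂ); ℂ)` of HODGE TYPE `(6,6)` lying in
`Eig((𝟙+φ)^*, (1+i√7)¹²) ⊔ Eig((𝟙+φ)^*, (1-i√7)¹²)` is in `algebraicClasses A.X 6 = N⁶H¹²`.

## Verdict (cycle 1): NO KILL — the statement resists, for the right reasons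

* It is an honest open instance of the Hodge conjecture (Weil classes for `K = ℚ(√-7)` on
  abelian 12-folds).  Every carrier is a real object, not an interface with junk inhabitants:
  `AbelianVariety ℂ` = proper geometrically-integral group scheme over `Spec ℂ` (Mumford §4),
  `dim` = topological Krull dimension (`schemeDim`), `complexBetti` = singular cohomology of `A(ℂ)`
  with the strong topology, `algebraicClasses` = coniveau `N^p H^{2p}` with the Mathlib scheme
  order (`a ≤ b ↔ b ⤳ a`, so `coheight` = codimension: `coheight_eq_zero_of_isGenericPoint_univ`),
  `IsRationalClass` = ℚ-valued cocycle, `IsOfHodgeType` = `∃ HodgeModel` (see §4).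
* Refutation barrier: Hodge–Weil classes on abelian varieties are MOTIVATED (André 1996), so a
  counterexample refutes the Lefschetz standard conjecture
  (`Literature.Barriers.HodgeConjecture.MotivatedClassesAbelianVarieties`,
  `not_lefschetzStandardConjecture_of_counterexample`).  No junk model evades it: `A.dim = 12` excludes the
  zero abelian variety (the only group scheme over `Spec ℂ` the tree can build today), and on the
  zero abelian variety `H¹² = 0` anyway.
* Nearest negative results in print bite only OFF projectivity: Zucker 1977 / Voisin 2002 Weil TORI
  (`Literature.Barriers.HodgeConjecture.KaehlerCounterexamples`, `.KaehlerCoherentSheaves`); our `A`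
  is projective (abelian VARIETY), so they are evaded by hypothesis, not by argument.

## Verdict (cycle 2, 2026-08-16): STILL NO KILL — three new formal sections, two more Negative files

* NEW §6 (formal, no hypothesis on `A` or `φ`): the REAL STRUCTURE of the typing.  Complex conjugation
  `conjClass` of the tree (conjugation of cochain values; natural, conjugate-linear, fixes rational
  classes — `Literature/AlgebraicGeometry/HodgeTheory/ComplexConjugation`) maps `Eig(g^*, μ)` onto
  `Eig(g^*, conj μ)` for EVERY scheme endomorphism `g`; since `conj((1+i√7)^12) = (1-i√7)^12 ≠ (1+i√7)^12`
  it SWAPS the two typed eigenspaces.  Consequences, all kernel-checked: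
  (a) `rational_mem_plusEigenspace_eq_zero` / `…minus…`: a rational class lying in ONE typed eigenspace
      is `0` — so the two SINGLE-EIGENSPACE STRENGTHENINGS of the typing are VACUOUS, and the corresponding
      variants of the crux are PROVABLE today (`onlyPlusVariant_holds`, `onlyMinusVariant_holds`): a
      statement typed that way would be trivially true (misstated), the `⊔` is essential;
  (b) `weilComponents_conj`: for a rational `c = c₊ + c₋` in the typed plane, `conj c₊ = c₋` — the two
      Weil components of a rational class are conjugate, in particular BOTH non-zero when `c ≠ 0`
      (`weilComponent_rational_imp_zero`: a rational `c₊` forces `c = 0`), so the crux can never be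
      applied to a component separately;
  (c) `components_mem_span_pair` (pure linear algebra): `c₊, c₋ ∈ span_ℂ {c, (𝟙+φ)^* c}` — the 2×2
      inversion behind `WeilDescending`'s "λα w₊ + λ̄ᾱ w₋" step, with `λ ≠ λ̄` = `weilEigenvalues_twelve_ne`.
  A refuter gains nothing from (a)–(c) (they constrain witnesses: any counterexample class has two
  conjugate non-zero non-rational components); a prover gains the splitting/recombination toolkit.
* NEW §7 (formal): WHERE A KILL WOULD PROPAGATE.  The crux is literally rung `(p, g') = (7, 3)` of the
  target (`weilTwelvefolds_of_ladder`, by instantiation — the `((7:ℕ):ℤ)`/`Real.sqrt ((7:ℕ):ℝ)`/`2*6`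
  spellings of `HodgeWeilLadder` are definitionally those of the crux), so `¬crux ⇒ ¬HodgeWeilLadder`
  (`not_ladder_of_not_weilTwelvefolds`); and with `WeilDescending` the crux implies the sixfold rung
  (`weilSixfolds_of_weilTwelvefolds`, three descents `6 → 5 → 4 → 3` through the abstract
  `descend_logic`), so `WeilDescending ⇒ ¬WeilSixfoldsSqrtMinus7 ⇒ ¬crux`
  (`not_weilTwelvefolds_of_not_weilSixfolds`): every attack on the sixfold crux 1260 (standing disprover
  there) is an attack here, and the planner's claim "rung (7,3) covers WeilSixfoldsSqrtMinus7" is now a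
  theorem rather than a docstring.
* NEW §8 (formal, `decide`/`omega`/`nlinarith`): the MECHANISM's bookkeeping re-derived in the kernel —
  `g(C̃) = 43` and `g(C) = 15` are the unique solutions of Riemann–Hurwitz for the étale `F₂₁`- and
  `μ₃`-covers, `dim P = 12`, `n = (7-1)/2·(3-1) = 6`, Weil component `n² = 36` ⊃ Prym locus `3g'-3 = 6`
  (codimension 30), `mult_χ = (2g'-2)·3 = 12`, `|F₂₁| = 1+1+1+9+9`, `dim Sym¹²ℂ³ = C(14,2) = 91 = 3 + 88`;
  and the STRUCTURAL REMARK "Hecke–Prym loci are never dominant" as the inequality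
  `3g'-3 < m²(g'-1)²` for all `m ≥ 3`, `g' ≥ 2` (`prymLocus_not_dominant`; Schoen's cyclic `6 > 4` is the
  contrast).  Nothing in the planner's arithmetic is off.
* Literature re-check (2026-08-16, S2; OpenAlex/arXiv rate-limited, searchd rc 75): nothing new in dimension ≥ 8 —
  Markman's ICM survey arXiv:2509.23403 §12 "What about Weil classes on abelian varieties of dimension ≥ 8?"
  (p. 20, read): only a HOPE conditional on a stronger semiregularity theorem; 2026 items (arXiv:2603.20268
  sixfolds/McMullen curve; arXiv:2607.18341 van Geemen–Rapagnetta, fourfolds; Floccari–Fu, fourfolds disc 1)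
  stay in dimension ≤ 6.  No printed counterexample or obstruction for ℚ(√-7) in any dimension.
* DEGENERATE MEMBERS of the crux's family (paper check, consistent with truth): CM points of type `E¹²`
  (`E = ℂ/O_K`) with a `(6,6)`-signature `K`-action — there `B^*(Eⁿ)` is generated by divisors (Hodge group
  `U(1)`, `∧ᵖV ⊗ ∧ᵖV̄ ⊂ Symᵖ(V ⊗ V̄)`), so the Weil classes ARE algebraic; split members `B₁ × B₂ × B₃`
  (Weil fourfolds, Markman/Floccari–Fu) or sixfold(disc -1) × fourfold products — algebraic by Künneth;
  so a counterexample, if any, sits at a non-CM-split interior member, where nothing is computable.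
* Re-checked for cycle 2: negatives index (HodgeConjecture) = 2 entries, both foreign to Weil classes
  (Fermat/K3 multisets, item 11121; a 22×22 matrix identity, item 12555); barrier catalogue unchanged
  (André-motivated ⇒ a kill refutes Lefschetz `B` on André's auxiliary varieties; Kähler counterexamples
  are off-projective).  REQUIREMENTS FOR ANY FORMAL KILL, made explicit: (i) a Lean-constructed abelian
  12-fold with `√-7` (none: the tree builds no positive-dimensional abelian variety), (ii) a `HodgeModel`
  of it (the `∃` in `IsOfHodgeType` is on the refuter's side but needs GAGA + de Rham + Hodge
  decomposition as an INSTANCE), (iii) a rational class of the typed plane of genuine type `(6,6)`, and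
  (iv) a proof that it is not in `N⁶H¹²` — i.e. literally a counterexample to the Hodge conjecture for a
  motivated class.  No side door through typing, junk models or degenerate parameters exists.

## Verdict (cycle 3, 2026-08-16, g3 seat): STILL NO KILL — but a SCOPE GAP between the crux and its mechanism

* ARTIFACT RE-AUDIT AT SOURCE (cycle 3 re-read the Literature carriers, not only their docstrings):
  `IsRationalClass` = ℚ-valued cocycle (`RationalHodgeClasses.lean:79`); `HodgeModel` = analytification
  (`IsAnalytification`, Osgood-unique) + de Rham family NATURAL over all `C^∞` maps of manifolds charted on the
  model space (`ComplexDeRhamIsoFamily.IsNatural`; `[PullbackFacts]` is a `Prop`-class of true facts, so the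
  naturality is unconditional in the model) + `isInternal_hodgePQ`; `IsOfHodgeType = ∃ model` (Thom/pinch
  argument pins the comparison to a scalar, module docstring of `RationalHodgeClasses`); `algebraicClasses X p =
  supportedClasses X (2p) p = ⨆_{Z closed, ∀ z ∈ Z, p ≤ coheight z} ker (H^{2p}(X(ℂ)) → H^{2p}((X∖Z)(ℂ)))`
  (`AlgebraicClasses.lean:112`; `Z = ∅` contributes `0`, components of codimension `> p` contribute `0` since
  `H^{BM}_{2n-2p}` of a real-`(2n-2p-2)`-dimensional set vanishes — no junk); `Hom(A, B)` additive structure =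
  Mathlib's `Hom.commGroup` of the commutative group object transported (`AbelianVariety.lean:131`), so
  `𝟙 A + φ` and `(7 : ℤ) • 𝟙 A` are the genuine group-law sum and `[7]`.  VERDICT: faithful; the crux is an
  honest instance of the Hodge conjecture, exactly as cycles 1–2 concluded.
* NS IS FREE (cycle 3 READ Patel–Zhang arXiv:2506.13729, p. 3, Thm 1.2: "The Hodge classes `U_Weil =
  ∧^h_{ℚ[G]_nt} H¹(B, ℚ)` are represented by algebraic cycles" for EVERY étale abelian `G`-cover `C → C'` with
  `g(C') ≥ 2`, `h = 2g(C') - 2`, `B = Prym`; no genericity hypothesis): with `G = N = ℤ/7`, base `D = C̃/N` of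
  genus `7`, `h = 12`, the three pure Schoen lines `e_a^{12} ⊗ det M_χ` are algebraic on the 36-fold
  `B = Prym(C̃ → D)`, and `ι^*` along `ι : P ↪ B` (`ι^* = μ₃`-averaging on `H¹`, an isomorphism
  `e_a ⊗ M_χ → v ⊗ M_χ`) maps `∧¹²(e_a ⊗ M_χ)` to `3^{-12}·w_σ(P)`.  So the triage consensus (r1-1, r1-3) is
  CONFIRMED by the adversary: `NS(7,3)` is a corollary, the crux is `Transport(7,3) + det H` (+ descending).
* NEW (§10, formal arithmetic + cited geometry): THE CRUX RANGES OVER INFINITELY MANY COMPONENTS, THE MECHANISM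
  REACHES FINITELY MANY.  `WeilTwelvefoldsSqrtMinus7` quantifies over ALL `(A, φ)` of dimension `12`, i.e. over
  every discriminant class `det H ∈ ℚ^*/Nm(K^*)` of sign `(-1)^6` (van Geemen 1994, Lemma 5.2(3): isogeny
  invariant; 4.14 / 5.3–5.4: EVERY class carries a `36`-dimensional family).  `ℚ_{>0}/Nm(ℚ(√-7)^×)` is INFINITE
  — kernel-checked here: `discriminantClasses_infinite` (reciprocity `(-7/ℓ) = (ℓ/7)`, descent `ℓ·m ∉ Nm` for
  inert `ℓ ∤ m`, Dirichlet `ℓ ≡ 3 (7)`), landed as `Negative/DiscriminantClasses.lean` (p76015, ACCEPTED).  The (7,3)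
  Hecke–Prym loci are finitely many continuous families (finitely many topological types of étale
  `F₂₁`-covers over the irreducible `M₃`; generic `End⁰(P) = K` ⇒ one polarization up to `ℚ^×`), so they meet
  FINITELY MANY classes; Transport (= an instance of the variational Hodge conjecture) is confined to the
  algebraic family it starts in (`det H` locally constant); and `WeilDescending` moves discriminants only one
  dimension DOWN (`det H(A × E × E') ≡ -ab·det H(A)`: ONE class in dimension `2n+2` gives ALL classes in
  dimension `2n` — Koike / Markman §1.1 — never sideways).  CONSEQUENCES for lead and planner:
  (i) `NS + T + det H` at `(7,3)` proves the crux on finitely many of infinitely many components — it does NOT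
  close item 1261 as stated; (ii) it DOES close crux 1260 (ALL ℚ(√-7) sixfolds, every discriminant — beyond
  Markman's `disc = -1`) and all dimensions `≤ 10`, by descending with `ab ≡ -δ₀/δ`; (iii) 1261 as stated is
  reached inside the route only from rung `(7,4)` (dimension `18`: `NS(7,4)` free again by Patel–Zhang with
  `h = 18`; `Transport(7,4)` from a `9`-dimensional Prym locus in an `81`-dimensional component) plus three
  descents `18 → 16 → 14 → 12`; (iv) the honest one-rung statement the (7,3) mechanism proves is "HWA(7,6) on
  the components met by (7,3)-Hecke–Pryms", not typable until `weilDiscriminant` (planner's definition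
  request) lands.  This is a planning finding (`refuted-*` does not apply: the crux is implied by HC).
* TRANSPORT, first-order heuristic (not a theorem; precedent: triage r1-3 E6 killed a sheaf design by the
  count `15 < 21`): a Bloch-semiregular cycle `Z ⊂ P₀` deforms to first order along every direction of the
  Hodge locus of `[Z]` (`⊇` the `36` Weil directions); a cycle all of whose embedded deformations are induced by
  deforming the `F₂₁`-cover (`dim M₃ = 6` parameters) moves along `≤ 6 < 36` directions and is therefore NOT
  semiregular.  The pulled-back Schoen/Patel–Zhang cycles are built from `Sym^{12}` of the curve and the
  Abel–Jacobi map; whether their Hilbert scheme at `[Z]` sees more than the `6` curve directions is the first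
  thing a Transport line must compute (`36 - 6 = 30` missing directions; `prymLocus_not_dominant`).
* Literature refresh attempted 2026-08-16T02:20Z: `lit search` rc 75 (searchd unavailable) — nothing new could be
  checked beyond cycle 2's sweep; GAP certificate j010194 (cycle 2, `F₂₁` Hecke bookkeeping) still queued on the
  farm (owner g2 seat; auto-attaches to the item).

## Verdict (cycle 4, 2026-08-16, g4 seat): STILL NO KILL — the two registered LINES audited stub by stub (§11)

* NEW SINCE CYCLE 3: two crux-plan skeletons are registered and checked —
  `Lines/amnesic-secant-sheaves-split-fourteenfolds.lean` (aimed descent `14 → 12` + C⁺ = HWA on HYPERBOLIC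
  ℚ(√-7) 14-folds via an "amnesic" semiregular secant object; stubs S1–S5) and
  `Lines/isotypic-unimodular-saturation.lean` (Schoen/PZ lines ⇒ Hecke–Prym Weil plane ⇒ product anchors in every
  discriminant ⇒ C⁺ = TRANSPORT (variational Hodge) ⇒ descent; six stubs).  No line is picked yet (no PICKED.md,
  `lead_cycles = 0`, payload `targets = []`); the adversary took all eleven stubs as Targets anyway.
* HEADLINE (§11d, card-level FALSIFICATION inside the amnesic line, formal + reproducible arithmetic): the idea card's
  displayed secant object — "rank 2, `c(F) = 1 + Θ + 2Θ²`, `ch = e^{αΘ}+e^{ᾱΘ} ∈ P_α`, moments `(2,1,-3,-5,1,11,9,-13)`;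
  any `≥ 8` integral slopes solve the moment system by Vandermonde" — does NOT exist as a theta-monad: Vandermonde
  solves over `ℚ` only, and `Tr C(α,4) = Tr((α-1)/3) = -1/3 ∉ ℤ` obstructs every complex of direct sums of
  theta-powers on every ppav of dimension `≥ 4` (`no_thetaComplex_with_unit_secant_moments`: `Σ n_m·m(m-1)(m-2)(m-3)
  = -8` vs `24 ∣` each term).  The theta-realizable rational points of `P_α` on a ppav 7-fold are
  `c·e^{αθ} + c̄e^{ᾱθ}`, `c ∈ 45·ℤ[α]` — ranks in `45ℤ` (FORMAL: `thetaComplex_secant_rank_dvd_fortyfive`, from the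
  integrality of `Σ n_m C(m,5)`, `Σ n_m C(m,6)` modulo the secant recurrence `M_{i+2} = M_{i+1} - 2M_i`); smallest: `c = 45α`, slopes `-3..3`, multiplicities
  `(-4, 42, -210, 560, -420, 84, -7)` (`thetaComplex_rank45_moments`, `rank45_moments_are_secant`).  So the amnesic
  `F`, if it is a theta-monad as the card defines it, has rank `≥ 45` and `~10³` summands; the "simple,
  `dim Ext²(F,F)^G = 42`" budget must be re-fought at that size (`χ(F,F) = 0` gives no help), or the object must
  leave the theta lattice (`μ_r`-twists / curve classes, both excluded by the card for `F`).  Stub S1 itself is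
  untouched (HC-implied); the LINE's mechanism lost its cheap instance.  Evidence: `theta_moments.py/.out`.
* RESULT (§11 verdict table): NO STUB IS REFUTABLE.  Both C⁺ stubs (`stub_hyperbolicFourteenfolds`,
  `stub_transport`) have conclusions implied by the Hodge conjecture (motivated classes, André) — irrefutable by
  any cheap attack; every other stub is TRUE (published theorem: `stub_schoenLines` = Patel–Zhang Thm 1.2 instance;
  classical: `stub_reach`, `stub_hyperbolicPartner`, `stub_productAnchor`, `stub_heckePrymWeilPlane`,
  `stub_hodgeTypeExterior`; pure algebra provable now: `stub_aimingArithmetic`; HC-implied: both `stub_descent`s).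
  Junk/degenerate instances of every interface were tried (`Jacobian C` for `C = ∅`/disconnected, `σ = 𝟙`,
  zero abelian variety, `hodgePQ` off `p+q = k`, `n = 0`, non-ample `h`, `g = 0` isogeny pairs): none bites.
* NEW FORMAL CONTENT (§11, all `sorry`-free): (a) TYPING CERTIFICATE for the isotypic line's new device
  `(2·𝟙_B + s_B)^*`: `twoAddZeta7_prod_eq_pow_iff` — `∏_b (2+ζ₇^b)^{k_b} = (2+ζ₇^a)^{12}` iff the multi-index is
  pure (`minpoly_ℤ ζ₇ = Φ₇`, reduction mod the six primes over `43 = Φ₇(-2)`), so `stub_schoenLines` types EXACTLY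
  the Schoen line; `oneAddZeta7_collision` — `(𝟙+s_B)^*` would not separate (`(1+ζ)⁵(1+ζ⁶)⁷ = (1+ζ)¹²`);
  `gaussSum7_sq` — `(ζ+ζ²+ζ⁴-ζ³-ζ⁵-ζ⁶)² = -7` (the scalar in `φ'² = -7`).  (b) DESCENT CONSTANTS for both
  `stub_descent`s: the four `(𝟙+ψ)^*`-eigenvalues are pairwise distinct, `q(X) = X² - 3735552·X + 4398046511104`,
  `q(λ±¹⁴) ≠ 0`, `(1+i√7)¹⁴ = -712704 - 745472·i√7`.  (c) TIGHTNESS of `stub_aimingArithmetic`: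
  `binaryWeilForm_one_neg_three_anisotropic` — for every admissible `K`, `diag(1,-3)` on `K²` has no isotropic
  `K`-line, so the stub's weights `(m₁, m₂)` cannot be dropped; and LITERALLY `not_aimingArithmeticUnitWeights :
  ¬ AimingArithmeticUnitWeights` (the stub with `m₁ = m₂ = 1` forced), refuted on a genuine Lean MODEL of `ℚ(√-7)` —
  `K7 = ℚ⟮i√7⟯ ⊂ ℂ`, `α7_mul_self`, `K7_span` (also a non-vacuity witness for the `(K, α, hK)` interface of the
  stub and of `Motives.diagWeilForm/weilDiscriminant`) — with `V = 0`, `E = 0`, `(r₁,r₂) = (1,3)`; serves the verbatim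
  twin stub of crux 1260's line.
* Flags for the lead (not falsities): S1's `h` is not required ample (Markman's engine wants a polarisation);
  `stub_reach` needs neat level (`det_K γ = ±1 → 1`) and partie fixe from a compactification; S4's Lean content is
  the product `HodgeModel`.  Literature refresh 2026-08-16T03:2xZ: `lit search` rc 75 (searchd down) — retried
  later in the cycle (see NOTES); negatives index unchanged (2 foreign entries).

## What this file certifies in Lean (all `sorry`-free unless marked)

§1 ARITHMETIC OF THE TYPING (the planner's "no mixed eigenvalue" claim, now kernel-checked, for ALL
   exponents at `p = 7`): `weilEigenvalue_pow_ne : 1 ≤ n → (1+i√7)^n ≠ (1-i√7)^n` (2-adic parity in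
   `ℤ[√-7]`: `(1+√-7)^(n+1) = 2^n (a + b√-7)` with `a ≡ b (mod 4)` odd), hence
   `mixed_eq_plus_iff : (1+i√7)^a (1-i√7)^b = (1+i√7)^(a+b) ↔ b = 0` and its mirror: inside
   `∧¹²(V_σ ⊕ V_σ̄)` the two typed eigenspaces are exactly `∧¹²V_σ` and `∧¹²V_σ̄` (the Weil plane),
   in every rung of the `p = 7` ladder (serves 1259@p=7, 1260, 1261, 1263@p=7).
   `weilEigenvalue_twelve : (1+i√7)^12 = -96256 + 92160·i√7` (non-real: a non-zero rational class never
   sits in ONE of the two eigenspaces, only in their sum).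
§1b THE SAME FOR EVERY RUNG: `one_add_I_sqrt_pow_ne : 4 ≤ d → 1 ≤ n → (1+i√d)^n ≠ (1-i√d)^n` via
   Niven's theorem (serves 1259 all `p`, 1262 at `p = 11`, 1263); landed as `Negative/LadderTyping.lean`.
§2 LOAD-BEARING ANALYSIS (`Without…` variants as `def`s; which hypothesis carries truth):
   only `IsOfHodgeType` is load-bearing for TRUTH (dropping it is false on `E¹²`, `E` CM by `ℤ[(1+√-7)/2]`,
   `φ = √-7` diagonal: the Weil plane has type `(12,0)+(0,12)`); `IsRationalClass` is REMOVABLE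
   (`algebraicClasses` is a ℂ-subspace and `W_K ⊗ ℂ` has a rational basis); `A.dim = 12`,
   `φ ≫ φ = -7` and the eigenspace condition only CARVE THE SECTOR — dropping any of them gives a
   statement still implied by the Hodge conjecture (larger, open, irrefutable here).  None of the
   `_false_without_` theorems is formally provable in the tree (each needs a Lean-constructed abelian
   12-fold); recorded as `def`s with the mathematical verdict in the docstring.
§3 REFUTED STRENGTHENINGS OF THE TYPING (why `7 ≤ p` and `(𝟙+φ)^*` — not `φ^*` — are essential):
   `typing_fails_sqrt3 : (1+i√3)^3 (1-i√3)^9 = (1+i√3)^12 ∧ (1+i√3)^12 = (1-i√3)^12`,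
   `typing_fails_gauss : (1+i)^4 = (1-i)^4`, `phiStar_does_not_separate : (i√7)^6 (-i√7)^6 = (i√7)^12`.
§4 THE `∃ HodgeModel` HYPOTHESIS (prose): why no exotic model enlarges `H^{6,6}` on an abelian variety —
   Osgood pins the complex structure (`IsAnalytification` quantifies over ALL affine opens and sections;
   `IsAnalytification.unique`), and two natural de Rham comparison families differ on `H^k(A^an)` by an
   automorphism commuting with `g^*` for every `g ∈ M_{24}(ℤ)` acting on the real torus `A^an`, hence by a
   scalar (Zariski density + irreducibility of `∧^k` of `GL_{24}`).  This is ALSO what a PROVER must show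
   to use `hhodge` (the model in the hypothesis is arbitrary) — flagged for the lead.
§5 TARGETS: none yet (payload `stuck_stubs = []` at cycles 1 and 2; no line picked, no skeleton).
§6 REALITY OF THE TYPING (cycle 2, formal): `conjClass_mem_eigenspace_map`, `eq_zero_of_isRationalClass_of_mem_eigenspace`,
   `rational_mem_plusEigenspace_eq_zero`, `onlyPlusVariant_holds`, `onlyMinusVariant_holds`,
   `weilComponents_conj`, `weilComponent_rational_imp_zero`, `components_mem_span_pair`.
§7 KILL PROPAGATION IN THE ROUTE (cycle 2, formal): `weilTwelvefolds_of_ladder`, `not_ladder_of_not_weilTwelvefolds`,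
   `descend_logic`, `weilSixfolds_of_weilTwelvefolds`, `not_weilTwelvefolds_of_not_weilSixfolds`.
§8 MECHANISM BOOKKEEPING (cycle 2, formal): `genus_bookkeeping_7_3`, `genus_cover_unique`, `genus_quotient_unique`,
   `dimension_bookkeeping_7_3`, `chevalleyWeil_bookkeeping_7_3`, `schoenLines_bookkeeping_7_3`,
   `prymLocus_not_dominant`, `schoen_cyclic_dominant`.
§10 DISCRIMINANT CLASSES (cycle 3, formal): `legendreSym_neg_seven`, `not_isSquare_neg_seven`,
   `dvd_of_dvd_sq_add_seven_mul_sq`, `not_norm_of_inert`, `inertPrimes_infinite`, `discriminantClasses_infinite`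
   (`ℚ_{>0}/Nm(ℚ(√-7)^×)` infinite ⇒ infinitely many dim-12 Weil components; the (7,3) anchors meet finitely
   many), `patelZhang_bookkeeping_7_3` / `_7_4` (the `h = 2g(D) - 2` of Thm 1.2 at rungs (7,3), (7,4)),
   `descending_reaches_every_class` (the `-ab` bookkeeping of `WeilDescending` is surjective on classes).
§11 TARGETS = the registered lines' stubs (cycle 4, formal): §11a `ζ7_isPrimitiveRoot`, `ζ7_cyclotomic`,
   `oneAddZeta7_collision`, `gaussSum7_sq`, `eval_zmod43_eq_zero_of_aeval_ζ7`, `root43_spec`,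
   `twoAddZeta7_prod_eq_pow_iff`; §11b `lam_mul_lamBar`, `ω_pow_ten`, `ω_pow_fourteen`, `weilEigenvalue_fourteen`,
   `descent_mixedEigenvalues_sum/prod`, `descent_eigenvalues_distinct`, `descentPoly_ne_zero_at_weil`;
   §11c `three_mul_sq_ne_norm`, `norm_eq_three_mul_norm`, `binaryWeilForm_one_neg_three_anisotropic`,
   the model `K7`/`α7`/`α7_mul_self`/`K7_span` of `ℚ(√-7)`, `AimingArithmeticUnitWeights`, `not_aimingArithmeticUnitWeights`;
   §11d `twentyfour_dvd_fallingFactorial_four`, `no_thetaComplex_with_unit_secant_moments`, `thetaComplex_rank45_moments`,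
   `rank45_moments_are_secant`, `thetaComplex_secant_rank_dvd_fortyfive` (dim ≥ 6: `45 ∣ rank`, FORMAL),
   `thetaComplex_secant_rank_dvd_three` (dim ≥ 4: `3 ∣ rank`) — the amnesic card's rank-2 theta-monad does not exist; rank ∈ 45ℤ exactly.

LANDED (importable, namespace `Summit.HodgeConjecture.HodgeConjecture.Theorems.WeilTwelvefoldsSqrtMinus7.Negative`,
directory `Summits/HodgeConjecture/HodgeConjecture/Theorems/WeilTwelvefoldsSqrtMinus7/Negative/`):
* `EigenvalueTyping.lean` (p72941, accepted 2026-08-16) = §1 + §3 (`one_add_I_sqrt7_pow_ne`, `mixed_eq_plus_iff`,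
  `mixed_eq_minus_iff`, `mixed_twelve`, `one_add_I_sqrt7_pow_twelve`, `weilEigenvalues_twelve_ne`,
  `typing_fails_sqrt3`, `typing_fails_gauss`, `phiStar_does_not_separate`, …);
* `LadderTyping.lean` (p73339) = §1b (`one_add_I_sqrt_pow_ne`, `ladder_weilEigenvalues_ne`,
  `mixed_eq_plus_iff_of_four_le`, `weilEigenvalues_ten_sqrt11_ne`, …);
* cycle 2: `WeilPlaneReality.lean` = §6 (p74558, ACCEPTED 2026-08-16, commit 78f9e21caf6c: `conjClass_mem_eigenspace_map`,
  `eq_zero_of_isRationalClass_of_mem_eigenspace`, `rational_mem_plusEigenspace_eq_zero`, `onlyPlusVariant_holds`,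
  `onlyMinusVariant_holds`, `weilComponents_conj`, `weilComponent_rational_imp_zero`, `components_mem_span_pair`, …)
  and `KillPropagation.lean` = §7 negative forms (p74804, ACCEPTED: `descend_logic`, `not_ladder_of_not_weilTwelvefolds`,
  `not_weilTwelvefolds_of_not_weilSixfolds`);
* cycle 3: `DiscriminantClasses.lean` = §10 (p76015, ACCEPTED 2026-08-16, commit 766b1d43669e: `legendreSym_neg_seven`,
  `not_isSquare_neg_seven`, `dvd_of_dvd_sq_add_seven_mul_sq`, `not_norm_of_inert`, `inertPrimes_infinite`,
  `discriminantClasses_infinite`).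
* cycle 4: `SchoenLinesTyping.lean` = §11a, `DescentPolynomial.lean` = §11b, `AimingArithmeticTightness.lean` = §11c,
  `AmnesicThetaMoments.lean` = §11d
  (proposed 2026-08-16 by the g4 seat; ids in the item's evidence notes / NOTES.md of the seat).

References: vanGeemen1994HodgeAV §§4–5, 7 (cycle 3 read book pp. 219–223: 4.14, Lemma 5.2, 5.3–5.4);
Weil1977HodgeRing; Markman2025SecantWeil §1.2 (secant anchors stop at sixfolds); Patel–Zhang arXiv:2506.13729
Thm 1.1–1.2 (p. 3, read cycle 3); Andre1996Motifs §0.6; Zucker 1977 App. B; Voisin 2002 IMRN.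
-/

noncomputable section

set_option linter.dupNamespace false

open Complex

namespace Summit.HodgeConjecture.HodgeConjecture.Cruxes.WeilTwelvefoldsSqrtMinus7.Disproof

open Summit.HodgeConjecture.HodgeConjecture.Theses.HeckePrymWeil

/-! ## §1 Arithmetic of the eigenvalue typing at `p = 7` -/

/-- `√7 : ℂ`, spelled exactly as in the crux (`((Real.sqrt 7 : ℝ) : ℂ)`). -/
abbrev s7 : ℂ := ((Real.sqrt (7 : ℝ) : ℝ) : ℂ)

theorem s7_mul_s7 : s7 * s7 = 7 := by
  simp only [s7]
  rw [← Complex.ofReal_mul, Real.mul_self_sqrt (by norm_num : (0 : ℝ) ≤ 7)]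
  push_cast
  rfl

theorem s7_ne_zero : s7 ≠ 0 := by
  simp only [s7, ne_eq, Complex.ofReal_eq_zero]
  exact (Real.sqrt_pos.2 (by norm_num : (0 : ℝ) < 7)).ne'

theorem Is7_mul_Is7 : (I * s7) * (I * s7) = ((-7 : ℤ) : ℂ) := by
  have h : (I * s7) * (I * s7) = (I * I) * (s7 * s7) := by ring
  rw [h, I_mul_I, s7_mul_s7]
  push_cast
  ring

theorem negIs7_mul_negIs7 : (-(I * s7)) * (-(I * s7)) = ((-7 : ℤ) : ℂ) := by
  rw [neg_mul_neg]
  exact Is7_mul_Is7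

/-- The embedding `ℤ[√-7] → ℂ`, `√-7 ↦ i√7`. -/
def emb : ℤ√(-7) →+* ℂ := Zsqrtd.lift ⟨I * s7, Is7_mul_Is7⟩

/-- The conjugate embedding `ℤ[√-7] → ℂ`, `√-7 ↦ -i√7`. -/
def embBar : ℤ√(-7) →+* ℂ := Zsqrtd.lift ⟨-(I * s7), negIs7_mul_negIs7⟩

theorem emb_apply (a : ℤ√(-7)) : emb a = (a.re : ℂ) + (a.im : ℂ) * (I * s7) :=
  Zsqrtd.lift_apply_apply _ _

theorem embBar_apply (a : ℤ√(-7)) : embBar a = (a.re : ℂ) - (a.im : ℂ) * (I * s7) := by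
  rw [embBar, Zsqrtd.lift_apply_apply]
  simp only [mul_neg, sub_eq_add_neg]

/-- `ω = 1 + √-7 ∈ ℤ[√-7]`; `emb ω = 1 + i√7` and `embBar ω = 1 - i√7` are the two eigenvalues of
`(𝟙 + φ)^*` on `H¹(A)` (`φ^* = ±i√7` on `V_σ`, `V_σ̄`). -/
def ω : ℤ√(-7) := ⟨1, 1⟩

theorem ω_re : ω.re = 1 := rfl
theorem ω_im : ω.im = 1 := rfl

theorem emb_ω : emb ω = 1 + I * s7 := by
  rw [emb_apply, ω_re, ω_im]; push_cast; ring

theorem embBar_ω : embBar ω = 1 - I * s7 := by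
  rw [embBar_apply, ω_re, ω_im]; push_cast; ring

theorem emb_ω_pow (n : ℕ) :
    (1 + I * s7) ^ n = ((ω ^ n).re : ℂ) + ((ω ^ n).im : ℂ) * (I * s7) := by
  rw [← emb_ω, ← map_pow, emb_apply]

theorem embBar_ω_pow (n : ℕ) :
    (1 - I * s7) ^ n = ((ω ^ n).re : ℂ) - ((ω ^ n).im : ℂ) * (I * s7) := by
  rw [← embBar_ω, ← map_pow, embBar_apply]

/-- **2-adic parity in `ℤ[√-7]`.** `(1+√-7)^(n+1) = 2^n · (a + b√-7)` with `a ≡ b (mod 4)` and `a` odd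
(so `b` is odd too).  Mechanism: `π = (1+√-7)/2` is a prime of norm `2` in `O_K = ℤ[π]`, `K = ℚ(√-7)`,
and `π^n ≡ (0,1) ∈ O_K/2 ≅ 𝔽₂ × 𝔽₂` never lies in the diagonal image of `ℤ + 2O_K = ℤ[√-7]`-reals;
here done by bare integer arithmetic (`omega`). [folklore] -/
theorem ω_pow_succ_dyadic (n : ℕ) : ∃ a b : ℤ,
    (ω ^ (n + 1)).re = 2 ^ n * a ∧ (ω ^ (n + 1)).im = 2 ^ n * b ∧ a % 4 = b % 4 ∧ a % 2 = 1 := by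
  induction n with
  | zero => exact ⟨1, 1, by simp [ω_re], by simp [ω_im], rfl, rfl⟩
  | succ n ih =>
    obtain ⟨a, b, hre, him, h4, h2⟩ := ih
    refine ⟨(a - 7 * b) / 2, (a + b) / 2, ?_, ?_, by omega, by omega⟩
    · have e : 2 * ((a - 7 * b) / 2) = a - 7 * b := by omega
      have e' : (2 : ℤ) ^ (n + 1) * ((a - 7 * b) / 2) = 2 ^ n * (a - 7 * b) := by
        rw [pow_succ, mul_assoc, e]
      rw [pow_succ ω (n + 1), Zsqrtd.re_mul, hre, him, ω_re, ω_im, e']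
      ring
    · have e : 2 * ((a + b) / 2) = a + b := by omega
      have e' : (2 : ℤ) ^ (n + 1) * ((a + b) / 2) = 2 ^ n * (a + b) := by
        rw [pow_succ, mul_assoc, e]
      rw [pow_succ ω (n + 1), Zsqrtd.im_mul, hre, him, ω_re, ω_im, e']
      ring

/-- The `√-7`-coordinate of `(1+√-7)^n` never vanishes (`n ≥ 1`). [folklore] -/
theorem ω_pow_im_ne_zero (n : ℕ) (hn : 1 ≤ n) : (ω ^ n).im ≠ 0 := by
  obtain ⟨m, rfl⟩ : ∃ m, n = m + 1 := ⟨n - 1, by omega⟩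
  obtain ⟨a, b, -, him, h4, h2⟩ := ω_pow_succ_dyadic m
  rw [him]
  have hb : b ≠ 0 := by omega
  exact mul_ne_zero (pow_ne_zero _ two_ne_zero) hb

/-- **Eigenvalue separation at `p = 7`, all exponents.** `(1+i√7)^n ≠ (1-i√7)^n` for `n ≥ 1`:
`(1-i√7)/(1+i√7) = (-3-i√7)/4` has norm `1` but is no root of unity (its minimal polynomial
`2x²+3x+2` is not monic).  This is the fact behind the TYPING of the Weil plane in every rung of the
`p = 7` ladder (items 1259@p=7, 1260, 1261) and behind the `λ ≠ λ̄` step of `WeilDescending` (1263).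
[folklore] -/
theorem weilEigenvalue_pow_ne (n : ℕ) (hn : 1 ≤ n) : (1 + I * s7) ^ n ≠ (1 - I * s7) ^ n := by
  intro h
  rw [emb_ω_pow, embBar_ω_pow] at h
  have h2 : (2 * ((ω ^ n).im : ℂ)) * (I * s7) = 0 := by linear_combination h
  have hne : (2 * ((ω ^ n).im : ℂ)) * (I * s7) ≠ 0 :=
    mul_ne_zero (mul_ne_zero two_ne_zero (Int.cast_ne_zero.2 (ω_pow_im_ne_zero n hn)))
      (mul_ne_zero I_ne_zero s7_ne_zero)
  exact hne h2

theorem one_add_Is7_ne_zero : (1 + I * s7) ≠ 0 := by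
  intro h
  have := congrArg Complex.re h
  simp [s7] at this

theorem one_sub_Is7_ne_zero : (1 - I * s7) ≠ 0 := by
  intro h
  have := congrArg Complex.re h
  simp [s7] at this

/-- **No mixed eigenvalue reaches the `σ`-Weil eigenvalue.** In `∧^{a+b}(V_σ ⊕ V_σ̄)` the summand
`∧^a V_σ ⊗ ∧^b V_σ̄` has `(𝟙+φ)^*`-eigenvalue `(1+i√7)^a (1-i√7)^b`; it equals `(1+i√7)^{a+b}` iff
`b = 0`.  So `Eig((𝟙+φ)^*, (1+i√7)^{2n}) = ∧^{2n} V_σ` exactly (given `H^{2n}(A) = ∧^{2n} H¹(A)`, not in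
the tree). [folklore] -/
theorem mixed_eq_plus_iff (a b : ℕ) :
    (1 + I * s7) ^ a * (1 - I * s7) ^ b = (1 + I * s7) ^ (a + b) ↔ b = 0 := by
  refine ⟨fun h => ?_, fun h => by subst h; simp⟩
  by_contra hb
  rw [pow_add] at h
  exact weilEigenvalue_pow_ne b (Nat.one_le_iff_ne_zero.2 hb)
    (mul_left_cancel₀ (pow_ne_zero a one_add_Is7_ne_zero) h).symm

/-- Mirror statement for the `σ̄`-Weil eigenvalue: `(1+i√7)^a (1-i√7)^b = (1-i√7)^{a+b} ↔ a = 0`.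
[folklore] -/
theorem mixed_eq_minus_iff (a b : ℕ) :
    (1 + I * s7) ^ a * (1 - I * s7) ^ b = (1 - I * s7) ^ (a + b) ↔ a = 0 := by
  refine ⟨fun h => ?_, fun h => by subst h; simp⟩
  by_contra ha
  rw [pow_add] at h
  exact weilEigenvalue_pow_ne a (Nat.one_le_iff_ne_zero.2 ha)
    (mul_right_cancel₀ (pow_ne_zero b one_sub_Is7_ne_zero) h)

/-- The crux instance (`2n = 12`): the two typed eigenvalues differ, so the `⊔` in the crux is a direct
sum and `(𝟙+φ)^*` separates `w₊` from `w₋`. [folklore] -/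
theorem weilEigenvalues_twelve_ne : (1 + I * s7) ^ 12 ≠ (1 - I * s7) ^ 12 :=
  weilEigenvalue_pow_ne 12 (by norm_num)

/-- The crux instance of "no mixed coincidence": for `a + b = 12` the mixed eigenvalue hits
`(1 ± i√7)^12` only at the two ends. [folklore] -/
theorem mixed_twelve (a b : ℕ) (hab : a + b = 12) :
    ((1 + I * s7) ^ a * (1 - I * s7) ^ b = (1 + I * s7) ^ 12 ↔ b = 0) ∧
    ((1 + I * s7) ^ a * (1 - I * s7) ^ b = (1 - I * s7) ^ 12 ↔ a = 0) := by
  rw [← hab]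
  exact ⟨mixed_eq_plus_iff a b, mixed_eq_minus_iff a b⟩

/-- `(1+√-7)^12 = -96256 + 92160·√-7` in `ℤ[√-7]` (kernel computation). [folklore] -/
theorem ω_pow_twelve : ω ^ 12 = ⟨-96256, 92160⟩ := by decide

/-- **Explicit typed eigenvalue** `(1+i√7)^12 = -96256 + 92160·i√7` (and `|·|² = 8^12 = 2^36`).  It is
NOT real, so a non-zero RATIONAL (hence conjugation-invariant) class can never lie in ONE of the two
eigenspaces of the real operator `(𝟙+φ)^*` — only in their sum `w₊ + w₋`; provers must always split
and recombine. [folklore] -/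
theorem weilEigenvalue_twelve :
    (1 + I * s7) ^ 12 = (-96256 : ℂ) + (92160 : ℂ) * (I * s7) := by
  rw [emb_ω_pow, ω_pow_twelve]
  push_cast
  ring

theorem weilEigenvalueBar_twelve :
    (1 - I * s7) ^ 12 = (-96256 : ℂ) - (92160 : ℂ) * (I * s7) := by
  rw [embBar_ω_pow, ω_pow_twelve]
  push_cast
  ring

theorem weilEigenvalue_twelve_im_ne_zero : ((1 + I * s7) ^ 12).im ≠ 0 := by
  rw [weilEigenvalue_twelve]
  simp [s7]

/-! ## §1b The typing device for EVERY rung (`d ≥ 4`, all exponents) — via Niven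

For the ladder target (1259: all primes `p ≡ 3 (4)`, `p ≥ 7`) and the sibling crux 1262 (`p = 11`) the
2-adic trick above does not transfer uniformly (`p + 1` may be a power of `2` exactly at Mersenne primes,
and `2` is inert for `p ≡ 3 (8)`); the uniform proof is: `μ = (1-i√d)/(1+i√d)` has `Re μ = (1-d)/(1+d) ∈ ℚ`
and `|μ| = 1`; if `μ^n = 1` then `μ = e^{2πik/n}` and Niven's theorem forces `(1-d)/(1+d) ∈ {0, ±1/2, ±1}`,
i.e. `d ∈ {0, 1/3, 1, 3}`.  Landed as `Negative/LadderTyping.lean` (same namespace as the companion). -/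

/-- **Single-operator eigenvalue separation for every `d ≥ 4` and every exponent** (Mathlib `niven` +
`Complex.mem_rootsOfUnity`): `(1+i√d)^n ≠ (1-i√d)^n` for `n ≥ 1`. [folklore] -/
theorem one_add_I_sqrt_pow_ne (d : ℕ) (hd : 4 ≤ d) (n : ℕ) (hn : 1 ≤ n) :
    (1 + I * ((Real.sqrt (d : ℝ) : ℝ) : ℂ)) ^ n ≠ (1 - I * ((Real.sqrt (d : ℝ) : ℝ) : ℂ)) ^ n := by
  set s : ℂ := ((Real.sqrt (d : ℝ) : ℝ) : ℂ) with hs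
  have ha : (1 + I * s) ≠ 0 := by
    intro h; have := congrArg Complex.re h; simp [hs] at this
  intro h
  set μ : ℂ := (1 - I * s) / (1 + I * s) with hμ
  have hμn : μ ^ n = 1 := by
    rw [hμ, div_pow, ← h, div_self (pow_ne_zero _ ha)]
  have hμ0 : μ ≠ 0 := by
    intro h0; rw [h0, zero_pow (by omega)] at hμn; exact zero_ne_one hμn
  haveI : NeZero n := ⟨by omega⟩
  let u : ℂˣ := Units.mk0 μ hμ0
  have hu : u ∈ rootsOfUnity n ℂ := by
    rw [_root_.mem_rootsOfUnity]; ext; simp [u, hμn]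
  obtain ⟨i, -, hexp⟩ := (Complex.mem_rootsOfUnity n u).1 hu
  have hexpμ : Complex.exp (2 * Real.pi * I * (i / n)) = μ := by simpa [u] using hexp
  have hre : μ.re = (1 - (d : ℝ)) / (1 + d) := by
    rw [hμ, Complex.div_re, Complex.normSq_apply]
    simp [hs]
    have h7 : Real.sqrt (d : ℝ) * Real.sqrt d = d := Real.mul_self_sqrt (Nat.cast_nonneg _)
    field_simp
    nlinarith [h7]
  have hθ : (Complex.exp (2 * Real.pi * I * (i / n))).re = Real.cos ((2 * i / n : ℝ) * Real.pi) := by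
    have : (2 * Real.pi * I * (i / n) : ℂ) = ((2 * i / n : ℝ) * Real.pi : ℝ) * I := by push_cast; ring
    rw [this, Complex.exp_ofReal_mul_I_re]
  have hcos : Real.cos ((2 * i / n : ℝ) * Real.pi) = (1 - (d : ℝ)) / (1 + d) := by
    rw [← hθ, hexpμ, hre]
  have hniv := niven (θ := (2 * i / n : ℝ) * Real.pi) ⟨(2 * i / n : ℚ), by push_cast; ring⟩
    ⟨((1 - d) / (1 + d) : ℚ), by rw [hcos]; push_cast; ring⟩
  rw [hcos] at hniv
  simp only [Set.mem_insert_iff, Set.mem_singleton_iff] at hniv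
  have hd' : (4 : ℝ) ≤ d := by exact_mod_cast hd
  have hpos : (0 : ℝ) < 1 + d := by linarith
  rcases hniv with h1 | h1 | h1 | h1 | h1 <;> rw [div_eq_iff hpos.ne'] at h1 <;> linarith

/-- Every rung `(p, n)` of `HodgeWeilLadder` (`7 ≤ p`, `1 ≤ n`) is honestly typed: its two eigenvalues
`(1 ± i√p)^{2n}` differ. [folklore] -/
theorem ladder_weilEigenvalues_ne (p : ℕ) (hp : 7 ≤ p) (n : ℕ) (hn : 1 ≤ n) :
    (1 + I * ((Real.sqrt (p : ℝ) : ℝ) : ℂ)) ^ (2 * n) ≠ (1 - I * ((Real.sqrt (p : ℝ) : ℝ) : ℂ)) ^ (2 * n) :=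
  one_add_I_sqrt_pow_ne p (by omega) (2 * n) (by omega)

/-! ## §3 Refuted strengthenings of the typing device

The crux types the Weil plane `W_K ⊗ ℂ = ∧¹²V_σ ⊕ ∧¹²V_σ̄` through eigenvalues of `(𝟙+φ)^*`.  Two
natural "simplifications" are FALSE as typings (they would enlarge the typed space beyond the Weil
plane, changing the statement into a larger chunk of the Hodge conjecture):
-/

/-- `√3 : ℂ`. -/
abbrev s3 : ℂ := ((Real.sqrt (3 : ℝ) : ℝ) : ℂ)

theorem s3_mul_s3 : s3 * s3 = 3 := by
  simp only [s3]
  rw [← Complex.ofReal_mul, Real.mul_self_sqrt (by norm_num : (0 : ℝ) ≤ 3)]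
  push_cast
  rfl

theorem Is3_sq : (I * s3) ^ 2 = -3 := by
  have h : (I * s3) ^ 2 = (I * I) * (s3 * s3) := by ring
  rw [h, I_mul_I, s3_mul_s3]
  ring

theorem one_add_Is3_cube : (1 + I * s3) ^ 3 = -8 := by
  have h : (1 + I * s3) ^ 3 = 1 + 3 * (I * s3) + 3 * (I * s3) ^ 2 + (I * s3) ^ 2 * (I * s3) := by
    ring
  rw [h, Is3_sq]
  ring

theorem one_sub_Is3_cube : (1 - I * s3) ^ 3 = -8 := by
  have h : (1 - I * s3) ^ 3 = 1 - 3 * (I * s3) + 3 * (I * s3) ^ 2 - (I * s3) ^ 2 * (I * s3) := by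
    ring
  rw [h, Is3_sq]
  ring

/-- **The typing fails for `K = ℚ(√-3)` (why the ladder needs `7 ≤ p`).**  With `√3` in place of `√7`
the would-be Weil eigenvalue `(1+i√3)^12` COINCIDES with the mixed eigenvalue of `∧⁹V_σ ⊗ ∧³V_σ̄` and
with the conjugate Weil eigenvalue: `(1+i√3)/(1-i√3)` is a primitive cube root of unity.  So the
statement "`HodgeWeilLadder` with `p = 3` allowed" would NOT be about Weil classes. [folklore] -/
theorem typing_fails_sqrt3 :
    (1 + I * s3) ^ 3 * (1 - I * s3) ^ 9 = (1 + I * s3) ^ 12 ∧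
      (1 + I * s3) ^ 12 = (1 - I * s3) ^ 12 := by
  have h9 : (1 - I * s3) ^ 9 = ((1 - I * s3) ^ 3) ^ 3 := by ring
  have h12 : (1 + I * s3) ^ 12 = ((1 + I * s3) ^ 3) ^ 4 := by ring
  have h12' : (1 - I * s3) ^ 12 = ((1 - I * s3) ^ 3) ^ 4 := by ring
  refine ⟨?_, ?_⟩
  · rw [h9, h12, one_add_Is3_cube, one_sub_Is3_cube]; norm_num
  · rw [h12, h12', one_add_Is3_cube, one_sub_Is3_cube]

/-- **The typing fails for `K = ℚ(i)`** (`(1+i)/(1-i) = i`): `(1+i)^4 = (1-i)^4 = -4`. [folklore] -/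
theorem typing_fails_gauss : (1 + I) ^ 4 = (1 - I) ^ 4 := by
  linear_combination (8 * I) * I_sq

/-- **`φ^*` itself does not separate** (why the crux uses `(𝟙+φ)^*`): on `∧^aV_σ ⊗ ∧^bV_σ̄` the
eigenvalue of `φ^*` is `(i√7)^a(-i√7)^b`, and for `(a,b) = (6,6)` (the big balanced summand, which
carries Hodge classes of its own) it equals the Weil eigenvalue `(i√7)^12 = (-i√7)^12 = 7^6`.
[folklore] -/
theorem phiStar_does_not_separate :
    (I * s7) ^ 6 * (-(I * s7)) ^ 6 = (I * s7) ^ 12 ∧ (-(I * s7)) ^ 12 = (I * s7) ^ 12 := by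
  constructor <;> ring

/-! ## §2 Load-bearing analysis

Each `Without…` is the crux with ONE hypothesis dropped.  Verdicts (mathematical; none is formally
decidable in the tree today because every witness needs a Lean-constructed abelian 12-fold — the tree
builds no positive-dimensional abelian variety):

* `WithoutHodgeType` — FALSE.  Witness: `A = E¹²`, `E = ℂ/ℤ[(1+√-7)/2]`, `φ = diag(√-7)` (`φ∘φ = -7`,
  `dim = 12`); `H¹ = V_σ ⊕ V_σ̄` with `V_σ = H^{1,0}`-side of signature `(12,0)`, so the Weil plane
  `∧¹²V_σ ⊕ ∧¹²V_σ̄ = H^{12,0} ⊕ H^{0,12}`; its rational points form a 2-dimensional ℚ-space of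
  non-zero classes of type `(12,0)+(0,12)`, never algebraic (cycle classes are `(6,6)`).  So the Hodge-type
  hypothesis is the ONE load-bearing hypothesis for truth.  (Also false on honest Weil type of
  signature `(a, 12-a)`, `a ≠ 6`.)
* `WithoutRationality` — EQUIVALENT to the crux (given the crux): on Weil type `(6,6)` the whole plane
  `W_K ⊗ ℂ` is of type `(6,6)` and is the ℂ-span of two rational classes; `algebraicClasses` is a
  ℂ-submodule.  Off Weil type both statements are vacuous (`c = 0`).  ⇒ "IsRationalClass possibly
  unnecessary" — information for the prover (it may prove the ℂ-linear statement directly).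
* `WithoutEigenspace` — the Hodge conjecture in codimension 6 for ALL rational `(6,6)`-classes on every
  abelian 12-fold with `ℤ[√-7] ⊂ End` — OPEN, strictly larger (exceptional classes in
  `∧^aV_σ ⊗ ∧^bV_σ̄`, products, CM members), implied by HC ⇒ irrefutable here.
* `WithoutDim` — for `dim A < 12` the typed eigenspaces vanish (`mixed_eq_plus_iff`: `∧¹²V_σ` needs
  `dim V_σ ≥ 12`), so it is TRUE there; for `dim A > 12` it asserts HC for the rational `(6,6)`-classes
  in `(∧¹²_K H¹(A,ℚ)) ⊗ ℂ` — OPEN, implied by HC.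
* `WithoutWeilRelation` (`φ` arbitrary) — eigenvalues `(1 ± i√7)^12` of `(𝟙+φ)^*` for a general `φ` cut
  out SOME conjugation-stable sub-Hodge-structure; rational `(6,6)`-classes in it are Hodge classes —
  OPEN, implied by HC (for `φ = m • 𝟙` the eigenspaces are `0`: `(1+m)^12` is real,
  `weilEigenvalue_twelve_im_ne_zero`).
-/

section Variants

open CategoryTheory Literature.AlgebraicGeometry

/-- The crux with the HODGE-TYPE hypothesis dropped — mathematically FALSE (`E¹²`, see §2). -/
def WithoutHodgeType : Prop :=
  ∀ (A : Motives.AbelianVariety ℂ) (φ : A ⟶ A), A.dim = 12 →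
    CategoryStruct.comp φ φ = -((7 : ℤ) • CategoryStruct.id A) →
    ∀ c : HodgeTheory.complexBetti A.X 12, HodgeTheory.IsRationalClass c →
      c ∈ Module.End.eigenspace (HodgeTheory.complexBetti.map (CategoryStruct.id A + φ).hom.hom.hom 12).hom
            ((1 + Complex.I * (Real.sqrt (7 : ℝ) : ℂ)) ^ 12) ⊔
          Module.End.eigenspace (HodgeTheory.complexBetti.map (CategoryStruct.id A + φ).hom.hom.hom 12).hom
            ((1 - Complex.I * (Real.sqrt (7 : ℝ) : ℂ)) ^ 12) →
      c ∈ HodgeTheory.algebraicClasses A.X 6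

/-- The crux with RATIONALITY dropped — mathematically EQUIVALENT to the crux (§2). -/
def WithoutRationality : Prop :=
  ∀ (A : Motives.AbelianVariety ℂ) (φ : A ⟶ A), A.dim = 12 →
    CategoryStruct.comp φ φ = -((7 : ℤ) • CategoryStruct.id A) →
    ∀ c : HodgeTheory.complexBetti A.X 12,
      HodgeTheory.IsOfHodgeType 12 A.X 12 6 6 c →
      c ∈ Module.End.eigenspace (HodgeTheory.complexBetti.map (CategoryStruct.id A + φ).hom.hom.hom 12).hom
            ((1 + Complex.I * (Real.sqrt (7 : ℝ) : ℂ)) ^ 12) ⊔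
          Module.End.eigenspace (HodgeTheory.complexBetti.map (CategoryStruct.id A + φ).hom.hom.hom 12).hom
            ((1 - Complex.I * (Real.sqrt (7 : ℝ) : ℂ)) ^ 12) →
      c ∈ HodgeTheory.algebraicClasses A.X 6

/-- The crux with the EIGENSPACE (Weil-plane) condition dropped — HC in codimension 6 on every abelian
12-fold with `√-7`-multiplication; OPEN, implied by HC (§2). -/
def WithoutEigenspace : Prop :=
  ∀ (A : Motives.AbelianVariety ℂ) (φ : A ⟶ A), A.dim = 12 →
    CategoryStruct.comp φ φ = -((7 : ℤ) • CategoryStruct.id A) →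
    ∀ c : HodgeTheory.complexBetti A.X 12, HodgeTheory.IsRationalClass c →
      HodgeTheory.IsOfHodgeType 12 A.X 12 6 6 c →
      c ∈ HodgeTheory.algebraicClasses A.X 6

/-- The crux with `A.dim = 12` dropped — true below dimension 12 (empty eigenspaces), a `∧¹²_K`-exceptional
class statement above; OPEN, implied by HC (§2). -/
def WithoutDim : Prop :=
  ∀ (A : Motives.AbelianVariety ℂ) (φ : A ⟶ A),
    CategoryStruct.comp φ φ = -((7 : ℤ) • CategoryStruct.id A) →
    ∀ c : HodgeTheory.complexBetti A.X 12, HodgeTheory.IsRationalClass c →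
      HodgeTheory.IsOfHodgeType 12 A.X 12 6 6 c →
      c ∈ Module.End.eigenspace (HodgeTheory.complexBetti.map (CategoryStruct.id A + φ).hom.hom.hom 12).hom
            ((1 + Complex.I * (Real.sqrt (7 : ℝ) : ℂ)) ^ 12) ⊔
          Module.End.eigenspace (HodgeTheory.complexBetti.map (CategoryStruct.id A + φ).hom.hom.hom 12).hom
            ((1 - Complex.I * (Real.sqrt (7 : ℝ) : ℂ)) ^ 12) →
      c ∈ HodgeTheory.algebraicClasses A.X 6

/-- The crux with `φ ≫ φ = -7` dropped (any endomorphism) — OPEN, implied by HC (§2). -/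
def WithoutWeilRelation : Prop :=
  ∀ (A : Motives.AbelianVariety ℂ) (φ : A ⟶ A), A.dim = 12 →
    ∀ c : HodgeTheory.complexBetti A.X 12, HodgeTheory.IsRationalClass c →
      HodgeTheory.IsOfHodgeType 12 A.X 12 6 6 c →
      c ∈ Module.End.eigenspace (HodgeTheory.complexBetti.map (CategoryStruct.id A + φ).hom.hom.hom 12).hom
            ((1 + Complex.I * (Real.sqrt (7 : ℝ) : ℂ)) ^ 12) ⊔
          Module.End.eigenspace (HodgeTheory.complexBetti.map (CategoryStruct.id A + φ).hom.hom.hom 12).hom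
            ((1 - Complex.I * (Real.sqrt (7 : ℝ) : ℂ)) ^ 12) →
      c ∈ HodgeTheory.algebraicClasses A.X 6

/-- Each variant is formally STRONGER than the crux (sanity: the variants really are the crux minus one
hypothesis — these five one-liners would break if a `Without…` drifted from the route text). -/
theorem crux_of_withoutHodgeType (h : WithoutHodgeType) : WeilTwelvefoldsSqrtMinus7 :=
  fun A φ hd hφ c hr _ he => h A φ hd hφ c hr he

theorem crux_of_withoutRationality (h : WithoutRationality) : WeilTwelvefoldsSqrtMinus7 :=
  fun A φ hd hφ c _ hh he => h A φ hd hφ c hh he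

theorem crux_of_withoutEigenspace (h : WithoutEigenspace) : WeilTwelvefoldsSqrtMinus7 :=
  fun A φ hd hφ c hr hh _ => h A φ hd hφ c hr hh

theorem crux_of_withoutDim (h : WithoutDim) : WeilTwelvefoldsSqrtMinus7 :=
  fun A φ _ hφ c hr hh he => h A φ hφ c hr hh he

theorem crux_of_withoutWeilRelation (h : WithoutWeilRelation) : WeilTwelvefoldsSqrtMinus7 :=
  fun A φ hd _ c hr hh he => h A φ hd c hr hh he

/-- **Rationality is removable modulo a ℚ-structure on the typed Weil plane.**  `H_span`: every class of
Hodge type `(6,6)` in the typed eigenspace sum is a ℂ-combination of RATIONAL such classes (true in print: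
`W_K = ∧^{2n}_K H¹(A,ℚ)` is a 2-dimensional ℚ-space with `W_K ⊗ ℂ = ∧¹²V_σ ⊕ ∧¹²V_σ̄`, all of type `(6,6)`
on Weil type, and `0` is the only `(6,6)`-class of the plane off Weil type; vanGeemen1994HodgeAV 4.9–4.11).
Granting it, the crux implies its rationality-free variant, because `algebraicClasses` is a ℂ-submodule —
so `IsRationalClass` carries no truth of its own ("possibly unnecessary": a prover may aim at the ℂ-linear
statement). [cite: vanGeemen1994HodgeAV, 4.9–4.11] -/
def WeilPlaneSpannedByRational : Prop :=
  ∀ (A : Motives.AbelianVariety ℂ) (φ : A ⟶ A), A.dim = 12 →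
    CategoryStruct.comp φ φ = -((7 : ℤ) • CategoryStruct.id A) →
    ∀ c : HodgeTheory.complexBetti A.X 12,
      HodgeTheory.IsOfHodgeType 12 A.X 12 6 6 c →
      c ∈ Module.End.eigenspace (HodgeTheory.complexBetti.map (CategoryStruct.id A + φ).hom.hom.hom 12).hom
            ((1 + Complex.I * (Real.sqrt (7 : ℝ) : ℂ)) ^ 12) ⊔
          Module.End.eigenspace (HodgeTheory.complexBetti.map (CategoryStruct.id A + φ).hom.hom.hom 12).hom
            ((1 - Complex.I * (Real.sqrt (7 : ℝ) : ℂ)) ^ 12) →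
      c ∈ Submodule.span ℂ {c' : HodgeTheory.complexBetti A.X 12 |
            HodgeTheory.IsRationalClass c' ∧ HodgeTheory.IsOfHodgeType 12 A.X 12 6 6 c' ∧
            c' ∈ Module.End.eigenspace
                  (HodgeTheory.complexBetti.map (CategoryStruct.id A + φ).hom.hom.hom 12).hom
                  ((1 + Complex.I * (Real.sqrt (7 : ℝ) : ℂ)) ^ 12) ⊔
                Module.End.eigenspace
                  (HodgeTheory.complexBetti.map (CategoryStruct.id A + φ).hom.hom.hom 12).hom
                  ((1 - Complex.I * (Real.sqrt (7 : ℝ) : ℂ)) ^ 12)}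

/-- `crux ∧ H_span ⟹ WithoutRationality` (and `WithoutRationality ⟹ crux` is `crux_of_withoutRationality`):
modulo the ℚ-structure of the Weil plane the rationality hypothesis is decoration. [folklore] -/
theorem withoutRationality_of_crux (hS : WeilPlaneSpannedByRational) (h : WeilTwelvefoldsSqrtMinus7) :
    WithoutRationality := by
  intro A φ hd hφ c hh he
  refine (Submodule.span_le.2 ?_) (hS A φ hd hφ c hh he)
  rintro c' ⟨hr', hh', he'⟩
  exact h A φ hd hφ c' hr' hh' he'

/-- PITFALL recorded for provers (no formal content): `(𝟙 + φ)^*` on `H¹²` is the pull-back along the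
ENDOMORPHISM `𝟙 + φ` (group law on `Hom`), which on `∧¹²H¹` is `∧¹²(1 + φ^*|_{H¹})` — it is NOT
`𝟙 + φ^*` on `H¹²` (pull-back is additive in the morphism only in degree `1`; e.g. `[2]^* = 2^k` on `H^k`).
The eigenvalues `(1 ± i√7)^12` are those of the former.  Any lemma of the form
`complexBetti.map (f + g) k = complexBetti.map f k + complexBetti.map g k` for `k ≥ 2` is FALSE. -/
theorem pitfall_pullback_not_additive_doc : True := trivial

/-- The conclusion is never the obstruction at `c = 0`, and the set of classes for which the crux's
implication holds is closed under `+` and `ℚ`-scaling on the hypothesis side (`IsRationalClass.add/smul`)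
and is a ℂ-submodule on the conclusion side: a refutation needs a GENUINELY non-algebraic rational Weil
class — i.e. a counterexample to the Hodge conjecture (André: then `¬ Lefschetz B`). [folklore] -/
theorem conclusion_zero (A : Motives.AbelianVariety ℂ) :
    (0 : HodgeTheory.complexBetti A.X 12) ∈ HodgeTheory.algebraicClasses A.X 6 :=
  Submodule.zero_mem _

end Variants

/-! ## §4 The `∃ HodgeModel` hypothesis and the prover's hidden obligation (prose)

`IsOfHodgeType 12 A.X 12 6 6 c := ∃ M : HodgeModel 12 A.X, M.pullback 12 c ∈ M.hodgePQ 12 6 6`.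
A refutation through an EXOTIC model (one whose `H^{6,6}` is larger than the genuine one, e.g. making a
type-`(12,0)` Weil class of `E¹²` count as `(6,6)`) is impossible on abelian varieties:
(1) `HodgeModel.isAnalytification` demands that EVERY section over EVERY affine open pull back
holomorphically and `HodgeModel.isManifold` gives a holomorphic atlas, so by Osgood
(`IsAnalytification.unique`) the complex structure of `M` is that of `A^an`, and `hodgePQ` is intrinsic to it;
(2) two natural de Rham comparison families differ on `H¹²(M; ℂ)` by a ℂ-linear automorphism `θ_M`
natural for smooth self-maps of `M`; `M = A^an` is the real torus `ℝ²⁴/ℤ²⁴` on which every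
`g ∈ M₂₄(ℤ)` acts smoothly, so `θ_M` commutes with `∧¹²g` for all such `g`, hence (Zariski density of
`M₂₄(ℤ)` in `M₂₄(ℂ)`, irreducibility of `∧¹²ℂ²⁴` under `GL₂₄`) `θ_M` is a SCALAR and fixes `e(H^{6,6})`.
Conversely this is exactly what a PROVER must establish to exploit `hhodge`: the model handed over is
arbitrary, so "Hodge type `(6,6)` in the model" must first be converted into the genuine Hodge type.
Neither (1) nor (2) is a theorem of the tree today (facts `IsAnalytification.unique`,
`exists_complexDeRhamIsoFamily`); flagged to the lead as a shared first stub of every line.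
-/

/-! ## §6 Reality of the typing (cycle 2, formal; no hypothesis on `A`, `φ`)

The tree's complex conjugation `conjClass Y k : Hᵏ(Y; ℂ) → Hᵏ(Y; ℂ)` (conjugation of the values of
singular cochains) is conjugate-linear (`conjClass_smul`), involutive, natural in continuous maps
(`conjClass_map`) and fixes rational classes (`IsRationalClass.conjClass_eq`).  Hence for every scheme
endomorphism `g` it maps `Eig(g^*, μ)` to `Eig(g^*, conj μ)`; with `conj((1+i√7)^12) = (1-i√7)^12 ≠ (1+i√7)^12`
it swaps the two typed eigenspaces of the crux.
-/

section Reality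

open CategoryTheory Literature.AlgebraicGeometry Literature.AlgebraicGeometry.HodgeTheory
open Literature.AlgebraicTopology.SingularHomology

section Generic

variable {Y : Type} [TopologicalSpace Y] {k : ℕ}

/-- **Conjugation maps `Eig(f^*, μ)` into `Eig(f^*, conj μ)`** for the pull-back along any continuous
self-map `f` (naturality + conjugate-linearity of `conjClass`). [folklore] -/
theorem conjClass_mem_eigenspace_map (f : C(Y, Y)) {μ : ℂ} {c : singularCohomology ℂ ℂ Y k}
    (hc : c ∈ Module.End.eigenspace (singularCohomology.map ℂ ℂ f k).hom μ) :
    conjClass Y k c ∈ Module.End.eigenspace (singularCohomology.map ℂ ℂ f k).hom (starRingEnd ℂ μ) := by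
  rw [Module.End.mem_eigenspace_iff] at hc ⊢
  have h := conjClass_map f (conjClass Y k c)
  rw [conjClass_conjClass] at h
  change (singularCohomology.map ℂ ℂ f k) (conjClass Y k c) = _
  have hc' : (singularCohomology.map ℂ ℂ f k) c = μ • c := hc
  apply (conjClassEquiv Y k).injective
  simp only [conjClassEquiv_apply]
  rw [h, hc', conjClass_smul, conjClass_conjClass]
  simp

/-- Membership in two eigenspaces with distinct eigenvalues forces `0`. [folklore] -/
theorem eq_zero_of_mem_eigenspace_of_mem_eigenspace {M : Type*} [AddCommGroup M] [Module ℂ M]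
    (f : Module.End ℂ M) {μ ν : ℂ} (hμν : μ ≠ ν) {c : M}
    (hμ : c ∈ f.eigenspace μ) (hν : c ∈ f.eigenspace ν) : c = 0 := by
  rw [Module.End.mem_eigenspace_iff] at hμ hν
  have h : (μ - ν) • c = 0 := by rw [sub_smul, ← hμ, ← hν, sub_self]
  exact (smul_eq_zero.1 h).resolve_left (sub_ne_zero.2 hμν)

/-- **A rational class in an eigenspace of a pull-back for a NON-REAL eigenvalue is zero**
(`conj c = c` lies in the `conj μ`-eigenspace too). [folklore] -/
theorem eq_zero_of_isRationalClass_of_mem_eigenspace (f : C(Y, Y)) {μ : ℂ} (hμ : starRingEnd ℂ μ ≠ μ)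
    {c : singularCohomology ℂ ℂ Y k} (hr : IsRationalClass c)
    (hc : c ∈ Module.End.eigenspace (singularCohomology.map ℂ ℂ f k).hom μ) : c = 0 := by
  have h := conjClass_mem_eigenspace_map f hc
  rw [hr.conjClass_eq] at h
  exact eq_zero_of_mem_eigenspace_of_mem_eigenspace _ hμ h hc

/-- **2×2 inversion.** If `c = c_μ + c_ν` with `f c_μ = μ c_μ`, `f c_ν = ν c_ν`, `μ ≠ ν`, then both
components lie in `span_ℂ {c, f c}`: `c_μ = (f c - ν c)/(μ-ν)`, `c_ν = (μ c - f c)/(μ-ν)`.  This is the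
linear algebra of `WeilDescending`'s recombination step (with `f = (𝟙+φ)^*`, `μ, ν = (1±i√7)^{2n}`).
[folklore] -/
theorem components_mem_span_pair {M : Type*} [AddCommGroup M] [Module ℂ M]
    (f : Module.End ℂ M) {μ ν : ℂ} (hμν : μ ≠ ν) {c cμ cν : M}
    (hμ : cμ ∈ f.eigenspace μ) (hν : cν ∈ f.eigenspace ν) (hc : c = cμ + cν) :
    cμ ∈ Submodule.span ℂ {c, f c} ∧ cν ∈ Submodule.span ℂ {c, f c} := by
  rw [Module.End.mem_eigenspace_iff] at hμ hν
  have hfc : f c = μ • cμ + ν • cν := by rw [hc, map_add, hμ, hν]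
  have hd : μ - ν ≠ 0 := sub_ne_zero.2 hμν
  have hcmem : c ∈ Submodule.span ℂ {c, f c} := Submodule.subset_span (by simp)
  have hfmem : f c ∈ Submodule.span ℂ {c, f c} := Submodule.subset_span (by simp)
  constructor
  · have key : (μ - ν) • cμ = f c - ν • c := by
      rw [hfc, hc, sub_smul, smul_add]; abel
    have : cμ = (μ - ν)⁻¹ • (f c - ν • c) := by
      rw [← key, smul_smul, inv_mul_cancel₀ hd, one_smul]
    rw [this]
    exact Submodule.smul_mem _ _ (Submodule.sub_mem _ hfmem (Submodule.smul_mem _ _ hcmem))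
  · have key : (μ - ν) • cν = μ • c - f c := by
      rw [hfc, hc, sub_smul, smul_add]; abel
    have : cν = (μ - ν)⁻¹ • (μ • c - f c) := by
      rw [← key, smul_smul, inv_mul_cancel₀ hd, one_smul]
    rw [this]
    exact Submodule.smul_mem _ _ (Submodule.sub_mem _ (Submodule.smul_mem _ _ hcmem) hfmem)

end Generic

/-- `conj √7 = √7`. [folklore] -/
theorem conj_s7 : starRingEnd ℂ s7 = s7 := Complex.conj_ofReal _

/-- `conj((1+i√7)^n) = (1-i√7)^n`. [folklore] -/
theorem conj_one_add_Is7_pow (n : ℕ) : starRingEnd ℂ ((1 + I * s7) ^ n) = (1 - I * s7) ^ n := by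
  rw [map_pow, map_add, map_one, map_mul, Complex.conj_I, conj_s7]
  ring

/-- `conj((1-i√7)^n) = (1+i√7)^n`. [folklore] -/
theorem conj_one_sub_Is7_pow (n : ℕ) : starRingEnd ℂ ((1 - I * s7) ^ n) = (1 + I * s7) ^ n := by
  rw [map_pow, map_sub, map_one, map_mul, Complex.conj_I, conj_s7]
  ring

/-- The typed eigenvalue `(1+i√7)^12` is not real: `conj` of it is the OTHER typed eigenvalue. [folklore] -/
theorem conj_weilEigenvalue_twelve_ne : starRingEnd ℂ ((1 + I * s7) ^ 12) ≠ (1 + I * s7) ^ 12 := by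
  rw [conj_one_add_Is7_pow]
  exact weilEigenvalues_twelve_ne.symm

theorem conj_weilEigenvalueBar_twelve_ne : starRingEnd ℂ ((1 - I * s7) ^ 12) ≠ (1 - I * s7) ^ 12 := by
  rw [conj_one_sub_Is7_pow]
  exact weilEigenvalues_twelve_ne

section Crux

variable (A : Motives.AbelianVariety ℂ) (ψ : A ⟶ A)

/-- **A rational class in the `+` typed eigenspace ALONE is zero** — for EVERY abelian variety `A` and
EVERY endomorphism `ψ` (no dimension or Weil relation needed). [folklore] -/
theorem rational_mem_plusEigenspace_eq_zero {c : complexBetti A.X 12} (hr : IsRationalClass c)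
    (hc : c ∈ Module.End.eigenspace (complexBetti.map ψ.hom.hom.hom 12).hom ((1 + I * s7) ^ 12)) :
    c = 0 :=
  eq_zero_of_isRationalClass_of_mem_eigenspace _ conj_weilEigenvalue_twelve_ne hr hc

/-- Mirror: a rational class in the `-` typed eigenspace alone is zero. [folklore] -/
theorem rational_mem_minusEigenspace_eq_zero {c : complexBetti A.X 12} (hr : IsRationalClass c)
    (hc : c ∈ Module.End.eigenspace (complexBetti.map ψ.hom.hom.hom 12).hom ((1 - I * s7) ^ 12)) :
    c = 0 :=
  eq_zero_of_isRationalClass_of_mem_eigenspace _ conj_weilEigenvalueBar_twelve_ne hr hc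

/-- **Refuted (as vacuous) strengthening of the typing: ONE eigenspace.**  The variant of the crux whose
Weil-plane hypothesis is `c ∈ Eig((𝟙+φ)^*, (1+i√7)^12)` alone is PROVABLE today — every admissible `c`
is `0`.  A statement typed this way would be trivially true (misstated); the `⊔` of BOTH eigenspaces in
the crux is essential. [folklore] -/
theorem onlyPlusVariant_holds :
    ∀ (A : Motives.AbelianVariety ℂ) (φ : A ⟶ A), A.dim = 12 →
      CategoryStruct.comp φ φ = -((7 : ℤ) • CategoryStruct.id A) →
      ∀ c : complexBetti A.X 12, IsRationalClass c → IsOfHodgeType 12 A.X 12 6 6 c →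
        c ∈ Module.End.eigenspace (complexBetti.map (CategoryStruct.id A + φ).hom.hom.hom 12).hom
              ((1 + Complex.I * (Real.sqrt (7 : ℝ) : ℂ)) ^ 12) →
        c ∈ algebraicClasses A.X 6 := by
  intro A φ _ _ c hr _ hc
  rw [rational_mem_plusEigenspace_eq_zero A _ hr hc]
  exact Submodule.zero_mem _

/-- Mirror: the `-`-only variant is equally vacuous. [folklore] -/
theorem onlyMinusVariant_holds :
    ∀ (A : Motives.AbelianVariety ℂ) (φ : A ⟶ A), A.dim = 12 →
      CategoryStruct.comp φ φ = -((7 : ℤ) • CategoryStruct.id A) →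
      ∀ c : complexBetti A.X 12, IsRationalClass c → IsOfHodgeType 12 A.X 12 6 6 c →
        c ∈ Module.End.eigenspace (complexBetti.map (CategoryStruct.id A + φ).hom.hom.hom 12).hom
              ((1 - Complex.I * (Real.sqrt (7 : ℝ) : ℂ)) ^ 12) →
        c ∈ algebraicClasses A.X 6 := by
  intro A φ _ _ c hr _ hc
  rw [rational_mem_minusEigenspace_eq_zero A _ hr hc]
  exact Submodule.zero_mem _

/-- **The Weil components of a rational class are conjugate**: if `c = c₊ + c₋` is rational with
`c± ∈ Eig(ψ^*, (1±i√7)^12)` then `conj c₊ = c₋` (uniqueness of the decomposition, eigenvalues distinct).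
[folklore] -/
theorem weilComponents_conj {c cp cm : complexBetti A.X 12} (hr : IsRationalClass c)
    (hp : cp ∈ Module.End.eigenspace (complexBetti.map ψ.hom.hom.hom 12).hom ((1 + I * s7) ^ 12))
    (hm : cm ∈ Module.End.eigenspace (complexBetti.map ψ.hom.hom.hom 12).hom ((1 - I * s7) ^ 12))
    (hc : c = cp + cm) : conjClass _ 12 cp = cm := by
  have hp' := conjClass_mem_eigenspace_map _ hp
  have hm' := conjClass_mem_eigenspace_map _ hm
  rw [conj_one_add_Is7_pow] at hp'
  rw [conj_one_sub_Is7_pow] at hm'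
  have hcc : conjClass _ 12 cp + conjClass _ 12 cm = cp + cm := by
    rw [← conjClass_add, ← hc, hr.conjClass_eq]
  have hd1 : conjClass _ 12 cp - cm ∈
      Module.End.eigenspace (complexBetti.map ψ.hom.hom.hom 12).hom ((1 - I * s7) ^ 12) :=
    Submodule.sub_mem _ hp' hm
  have heq : conjClass _ 12 cp - cm = cp - conjClass _ 12 cm := by
    rw [sub_eq_sub_iff_add_eq_add, hcc]
  have hd2 : conjClass _ 12 cp - cm ∈
      Module.End.eigenspace (complexBetti.map ψ.hom.hom.hom 12).hom ((1 + I * s7) ^ 12) := by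
    rw [heq]; exact Submodule.sub_mem _ hp hm'
  exact sub_eq_zero.1 (eq_zero_of_mem_eigenspace_of_mem_eigenspace _ weilEigenvalues_twelve_ne hd2 hd1)

/-- **Refuted strengthening: rational components.**  If the `+` component of a rational class of the
typed plane is itself rational, the class is `0` — the crux can never be applied to `c₊` or `c₋`
separately; provers must split and recombine (`components_mem_span_pair`). [folklore] -/
theorem weilComponent_rational_imp_zero {c cp cm : complexBetti A.X 12} (hr : IsRationalClass c)
    (hp : cp ∈ Module.End.eigenspace (complexBetti.map ψ.hom.hom.hom 12).hom ((1 + I * s7) ^ 12))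
    (hm : cm ∈ Module.End.eigenspace (complexBetti.map ψ.hom.hom.hom 12).hom ((1 - I * s7) ^ 12))
    (hc : c = cp + cm) (hpr : IsRationalClass cp) : c = 0 := by
  have h0 : cp = 0 := rational_mem_plusEigenspace_eq_zero A ψ hpr hp
  have h1 := weilComponents_conj A ψ hr hp hm hc
  rw [h0, conjClass_zero] at h1
  rw [hc, h0, ← h1, add_zero]

end Crux

end Reality

/-! ## §7 Kill propagation in the route (cycle 2, formal)

The crux is an INSTANCE of the target and, through `WeilDescending`, a STRENGTHENING of the sixfold
crux 1260: kills propagate crux ⇒ target and sixfolds ⇒ crux.  (Positive forms are kept here for the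
record; only the negative forms are landed under `Theorems/…/Negative/`.)
-/

section KillPropagation

/-- Pure logic of the ladder: a one-step descending rule lowers a rung predicate from `a` to any
`1 ≤ b ≤ a`. [folklore] -/
theorem descend_logic (P : ℕ → Prop)
    (hDesc : ∀ n : ℕ, 1 ≤ n → (∀ m : ℕ, m = n + 1 → P m) → P n)
    {a b : ℕ} (hb : 1 ≤ b) (hab : b ≤ a) (ha : P a) : P b := by
  obtain ⟨d, rfl⟩ : ∃ d, a = b + d := ⟨a - b, by omega⟩
  induction d generalizing b with
  | zero => simpa using ha
  | succ d ih =>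
    exact hDesc b hb fun m hm => ih (by omega) (by omega) (by rw [hm]; convert ha using 1; omega)

/-- **The crux is rung `(p, g') = (7, 3)` of `HodgeWeilLadder`** (instantiation; the casts
`((7:ℕ):ℤ)`, `Real.sqrt ((7:ℕ):ℝ)` and `2 * 6` of the target are definitionally the crux's). [folklore] -/
theorem weilTwelvefolds_of_ladder (hL : HodgeWeilLadder) : WeilTwelvefoldsSqrtMinus7 :=
  hL 7 (by norm_num) (by norm_num) le_rfl 3 (by norm_num) 6 (by norm_num)

/-- **A kill of the crux kills the target.** [folklore] -/
theorem not_ladder_of_not_weilTwelvefolds (h : ¬ WeilTwelvefoldsSqrtMinus7) : ¬ HodgeWeilLadder :=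
  fun hL => h (weilTwelvefolds_of_ladder hL)

/-- **With `WeilDescending` the crux implies the sixfold rung** (`6 → 5 → 4 → 3`): the planner's
"by WeilDescending this rung also delivers … in particular it covers WeilSixfoldsSqrtMinus7", now a
theorem. [folklore] -/
theorem weilSixfolds_of_weilTwelvefolds (hD : WeilDescending) (h : WeilTwelvefoldsSqrtMinus7) :
    WeilSixfoldsSqrtMinus7 :=
  descend_logic _ (hD 7 (by norm_num) (by norm_num) le_rfl) (by norm_num) (by norm_num : 3 ≤ 6) h

/-- **A kill of the sixfold rung kills the crux, given descending**: every attack of the standing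
disprover of 1260 is an attack here. [folklore] -/
theorem not_weilTwelvefolds_of_not_weilSixfolds (hD : WeilDescending) (h : ¬ WeilSixfoldsSqrtMinus7) :
    ¬ WeilTwelvefoldsSqrtMinus7 :=
  fun h12 => h (weilSixfolds_of_weilTwelvefolds hD h12)

end KillPropagation

/-! ## §8 Bookkeeping of the `(7,3)` Hecke–Prym mechanism (cycle 2, kernel arithmetic)

The MECHANISM text of the crux (not its statement) carries a dozen numbers; all re-derived here. -/

section Bookkeeping

/-- Riemann–Hurwitz for the étale `F₂₁`-cover `C̃ → C'`, `g(C') = 3`: `2·43 - 2 = 21·(2·3 - 2)`; for the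
étale quotient `C̃ → C = C̃/μ₃`: `2·43 - 2 = 3·(2·15 - 2)`; `dim P = g(C) - g(C') = 12`. [folklore] -/
theorem genus_bookkeeping_7_3 :
    2 * 43 - 2 = 21 * (2 * 3 - 2) ∧ 2 * 43 - 2 = 3 * (2 * 15 - 2) ∧ 15 - 3 = 12 := by decide

/-- `g(C̃) = 43` is forced by Riemann–Hurwitz. [folklore] -/
theorem genus_cover_unique (g : ℕ) (h : 2 * g - 2 = 21 * (2 * 3 - 2)) : g = 43 := by omega

/-- `g(C) = 15` is forced by Riemann–Hurwitz. [folklore] -/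
theorem genus_quotient_unique (g : ℕ) (h : 2 * 43 - 2 = 3 * (2 * g - 2)) : g = 15 := by omega

/-- `n = (p-1)/2·(g'-1) = 6`, `dim A = 2n = 12`, Weil component `n² = 36`, Prym locus `3g'-3 = 6`,
codimension `30` (transport is a genuine second crux). [folklore] -/
theorem dimension_bookkeeping_7_3 :
    (7 - 1) / 2 * (3 - 1) = 6 ∧ 2 * 6 = 12 ∧ 6 ^ 2 = 36 ∧ 3 * 3 - 3 = 6 ∧ 36 - 6 = 30 := by decide

/-- Chevalley–Weil: `mult_χ(H¹(C̃)) = (2g'-2)·dim χ = 12 = 2n` (so `dim M_χ = 12`, `dim H¹(P) = 24`);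
`|F₂₁| = 21 = 1² + 1² + 1² + 3² + 3²`; `dim H¹(C̃) = 2·1 + (2g'-2)·21 = 86 = 2·43`. [folklore] -/
theorem chevalleyWeil_bookkeeping_7_3 :
    (2 * 3 - 2) * 3 = 12 ∧ 12 + 12 = 2 * 12 ∧ 1 ^ 2 + 1 ^ 2 + 1 ^ 2 + 3 ^ 2 + 3 ^ 2 = 21 ∧
      2 * 1 + (2 * 3 - 2) * 21 = 2 * 43 := by decide

/-- `E_χ = Sym¹²χ ⊗ det M_χ` has dimension `C(14,2) = 91` (degree-12 monomials in 3 variables): `3` pure,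
`88` mixed. [folklore] -/
theorem schoenLines_bookkeeping_7_3 :
    Nat.choose (12 + 3 - 1) (3 - 1) = 91 ∧ Nat.choose 14 2 = 91 ∧ 91 - 3 = 88 := by decide

/-- **Hecke–Prym loci are never dominant** (route's STRUCTURAL REMARK): `3g' - 3 < m²(g'-1)²` for all
`m = (p-1)/2 ≥ 3`, `g' ≥ 2`; at `(7,3)`: `6 < 36`. [folklore] -/
theorem prymLocus_not_dominant (m g : ℕ) (hm : 3 ≤ m) (hg : 2 ≤ g) :
    3 * g - 3 < m ^ 2 * (g - 1) ^ 2 := by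
  obtain ⟨k, rfl⟩ : ∃ k, g = k + 2 := ⟨g - 2, by omega⟩
  have h1 : 3 * (k + 2) - 3 = 3 * (k + 1) := by omega
  have h2 : k + 2 - 1 = k + 1 := by omega
  rw [h1, h2]
  have hm2 : 9 ≤ m ^ 2 := by nlinarith
  nlinarith

/-- Contrast: Schoen's cyclic Prym map IS dominant in its first case (`dim M_{3,ℤ/3} = 6 > 4 = 2²`,
van Geemen §7), which is why specialization finishes there and not here. [folklore] -/
theorem schoen_cyclic_dominant : 2 ^ 2 < 6 := by decide

end Bookkeeping

/-! ## §9 Targets (lead's stuck stubs): none in payload at cycles 1–3 (no line picked yet); cycle 4: see §11 (all stubs of the two registered lines)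

PRE-TRIAGE of the candidate first lemmas in `Ideas/` + `IdeatorOneSketch.lean` / `IdeatorTwoSketch.lean`
(cycle 2; cheap attacks only, nothing refutable found — recorded so the lead knows where the adversary stands):

* `IdeatorTwo.DisjointPairCertificate` — its conclusion is the crux's conclusion under the crux's hypotheses, so
  `crux → DisjointPairCertificate`: NOT refutable short of refuting the crux.  But as a TRANSFER lemma it is
  UNDER-HYPOTHESISED for a formal proof: the paper argument needs (i) `IsOfHodgeType 12 A.X 12 6 6 zᵢ` for the
  algebraic `zᵢ` (to apply the genericity hypothesis; "algebraic ⇒ (p,p)" is a fact, not a hypothesis here),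
  (ii) `h6 ⌣ w = 0` for `w` in the typed plane and `T = 8¹²` on `H²⁴` (cup product naturality + degree of the
  isogeny `𝟙+φ`, or `H^* = ∧^*H¹`), (iii) `dim E± ≤ 1` (to pass from "`w₁±` algebraic", which §6
  `components_mem_span_pair` + `weilComponents_conj` deliver, to "all of `E₊ ⊔ E₋` algebraic").  Expect the stub to
  be STUCK on (iii) = the character-separation lemma, not false; a reshaped signature should carry (i)–(iii).
* `IdeatorOne.NormPullbackInjective` (`m ↦ f e₁ ⊗ m` injective for `f e₁ ≠ 0` over `ℂ`) — TRUE, PROVED below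
  (`normPullbackInjective_holds`: apply `λ ⊗ id` with `λ (f e₁) ≠ 0`); `UnimodularSaturation` (an `SL₃(ℤ)`-stable subspace of `Symᵏℂ³` is `0` or all) — TRUE
  (Zariski density of `SL₃(ℤ)` in `SL₃(ℂ)` + irreducibility of `Symᵏ`); the Pólya stub
  `∀ q > 0 on [0,∞), ∃ N, coeffs((1+X)^N q) ≥ 0` — TRUE (Pólya 1928 on the dehomogenised simplex; the leading
  coefficient is positive automatically; e.g. `q = X²-X+1`, `N = 1`: `X³+1`).  No kill available on any of them.
* `IdeatorTwo.HyperbolicTwelvefoldsSqrtMinus7`, `IdeatorOne.HypSplitFourteen…` — instances / one-rung-up forms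
  of the crux: open exactly like it (André barrier), irrefutable here.
-/

section PreTriage

open TensorProduct

/-- **`IdeatorOneSketch.NormPullbackInjective` HOLDS** (card isotypic-unimodular-saturation, its load-bearing
linear-algebra shadow, verbatim shape): `m ↦ f e₁ ⊗ m` is injective for `f e₁ ≠ 0` over `ℂ` — apply
`λ ⊗ id` with `λ (f e₁) ≠ 0`.  (Positive; recorded so that nobody mistakes this stub for the difficulty of
the line — the difficulty is the geometric NS statement, not this.) [folklore] -/
theorem normPullbackInjective_holds :
    ∀ (V M : Type) [AddCommGroup V] [Module ℂ V] [AddCommGroup M] [Module ℂ M]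
      (f : V →ₗ[ℂ] V) (e₁ : V), f e₁ ≠ 0 →
      Function.Injective ((TensorProduct.map f (LinearMap.id : M →ₗ[ℂ] M)) ∘ₗ (TensorProduct.mk ℂ V M e₁)) := by
  intro V M _ _ _ _ f e₁ hv
  obtain ⟨g, hg⟩ : ∃ g : Module.Dual ℂ V, g (f e₁) ≠ 0 := by
    by_contra h
    push Not at h
    exact hv ((Module.forall_dual_apply_eq_zero_iff ℂ (f e₁)).1 h)
  intro m m' hmm
  have key : ∀ x : M,
      (TensorProduct.lid ℂ M) (TensorProduct.map g (LinearMap.id : M →ₗ[ℂ] M)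
        (((TensorProduct.map f (LinearMap.id : M →ₗ[ℂ] M)) ∘ₗ (TensorProduct.mk ℂ V M e₁)) x)) =
        g (f e₁) • x := by
    intro x
    simp [TensorProduct.map_tmul]
  have h2 := congrArg (fun t => (TensorProduct.lid ℂ M) (TensorProduct.map g (LinearMap.id : M →ₗ[ℂ] M) t)) hmm
  simp only [key] at h2
  exact smul_right_injective M hg h2

end PreTriage


/-! ## §10 Discriminant classes: what the (7,3) mechanism can reach (cycle 3, formal arithmetic + cited geometry)

GEOMETRY (cited, not formalised — no `weilDiscriminant` in the tree): for a polarized abelian variety of Weil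
type `(A, K = ℚ(√-d), E)` of dimension `2n`, `det H ∈ ℚ^*/Nm(K^*)` is an isogeny invariant (van Geemen 1994,
Lemma 5.2(3)), of sign `(-1)^n` (5.2(4), 5.4), locally constant in algebraic families, and EVERY class of that
sign is realised by an `n²`-dimensional family (4.14, 5.3–5.4; rational Hermitian forms over `K` are classified
by rank, signature and `det`, so two families with the same class have isogenous members).  Hence the set of
dimension-`12` components the crux quantifies over is in bijection with `ℚ_{>0}/Nm(ℚ(√-7)^×)`, which this
section proves INFINITE; the (7,3) Hecke–Prym anchors lie in finitely many of them; `Transport` never leaves a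
component; `WeilDescending` maps ONE class in dimension `2n+2` onto ALL classes in dimension `2n`
(`descending_reaches_every_class`) and nothing moves sideways.  See the cycle-3 verdict in the module docstring
for the consequences (1261 as stated needs rung (7,4) + three descents; (7,3) fully done gives 1260 and all
dimensions `≤ 10`).

STRUCTURE OF THE LADDER BY DISCRIMINANT (paper, for the planner).  Write `HWA(2n, δ)` for "Hodge–Weil classes
algebraic on the `ℚ(√-7)`-Weil component of dimension `2n` and class `δ`" and `HWA(2n)` for all classes.  Then
(a) `HWA(2n+2, δ₀) ⇒ HWA(2n)` for ANY single `δ₀` (descending with `ab ≡ -δ₀/δ`, `descending_reaches_every_class`);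
(b) anchors + Transport give `HWA(2n, δ)` only for the classes `δ` the anchors realise.  So the minimal sufficient
family for the whole sector is ONE class per even dimension — and the natural one is the HYPERBOLIC class
`δ = (-1)^n` (Markman's `disc = -1` sixfolds; split products `X × X̂`; `A × E × E`).  Triage r1-1 (sharpen (b))
expects the (7,3) Hecke–Pryms to be hyperbolic too; made precise here (paper): a component of the Hurwitz space of
étale `F₂₁`-covers of genus-3 curves whose monodromy `ρ : π₁(Σ₃) ↠ F₂₁` kills the six curves of a pants
decomposition (i.e. factors through the handlebody quotient `π₁(Σ₃) ↠ F₃ ↠ F₂₁`, possible since `F₂₁` is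
2-generated) degenerates, over a graph curve of `M̄₃`, to an admissible cover with TRIVIAL node monodromy, all of
whose components are rational; `J(C̃)` and hence `P` degenerate totally torically, the vanishing lattice is an
`F₂₁`-stable Lagrangian whose `χ`-part is a `K`-stable `E`-isotropic subspace of `H₁(P, ℚ)` of `K`-dimension
`6 = 12/2` (Chevalley–Weil for the graph cover: `ℚ ⊕ ℚ[F]^{b₁-1}`, `b₁ = 3`, `χ`-multiplicity `2·3 = 6`), so the
Hermitian form `H` (van Geemen 5.2(2)) has a totally isotropic subspace of half dimension, is hyperbolic, and
`det H ≡ (-1)^6 = +1`.  Whether EVERY component of that Hurwitz space is of this kind is not settled here (no `H₂`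
obstruction: the Schur multiplier of `F₂₁` is trivial, all Sylow subgroups being cyclic).  UPSHOT: the (7,3) line's
direct reach is (at least, and expectedly exactly) the hyperbolic class `δ = +1` of dimension 12 — the SAME class the
secant-sheaf / product-anchor cards aim at — which yields `HWA(10), HWA(8), HWA(6) = crux 1260, HWA(4)`; item 1261 as
stated (`HWA(12)`) needs `HWA(14, δ₀)` for one `δ₀` (rung (7,4) reaches `HWA(18, ·)`, or the cards'
`HypSplitFourteen` = `HWA(14, -1)` on split fourteenfolds).

ARITHMETIC (formal): `q ∈ ℚ_{>0}` is a norm from `K = ℚ(√-7)` iff `q·c² = a² + 7b²` is solvable with `c ≠ 0`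
(`Nm((a + b√-7)/c) = (a² + 7b²)/c²`); two positive integers are equivalent modulo norms iff their product is a
norm.  Inert primes (`ℓ ≡ 3, 5, 6 (mod 7)`, i.e. `(-7/ℓ) = (ℓ/7) = -1`) are non-norms with any cofactor prime
to them (descent), and there are infinitely many (Dirichlet).  Landed as `Negative/DiscriminantClasses.lean`.
-/

section DiscriminantClasses

section Legendre

variable {ℓ : ℕ} [Fact ℓ.Prime]

/-- **`(-7/ℓ) = (ℓ/7)`** for every odd prime `ℓ`: `(-7/ℓ) = χ₄(ℓ)·(7/ℓ)` and quadratic reciprocity in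
the two cases `ℓ ≡ 1, 3 (mod 4)` (`7 ≡ 3 (mod 4)`). [folklore] -/
theorem legendreSym_neg_seven [Fact (Nat.Prime 7)] (hℓ2 : ℓ ≠ 2) :
    legendreSym ℓ (-7) = legendreSym 7 ℓ := by
  have h := legendreSym.at_neg hℓ2 7
  rcases Nat.Prime.eq_two_or_odd (Fact.out : ℓ.Prime) with h2 | hodd
  · exact absurd h2 hℓ2
  · have h4 : ℓ % 4 = 1 ∨ ℓ % 4 = 3 := by omega
    rcases h4 with h1 | h3
    · rw [h, ZMod.χ₄_nat_one_mod_four h1, one_mul]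
      exact (legendreSym.quadratic_reciprocity_one_mod_four h1 (by norm_num)).symm
    · rw [h, ZMod.χ₄_nat_three_mod_four h3,
        legendreSym.quadratic_reciprocity_three_mod_four h3 (by norm_num)]
      ring

/-- **The primes `ℓ ≡ 3, 5, 6 (mod 7)` are inert in `ℚ(√-7)`**: `-7` is not a square mod `ℓ`. [folklore] -/
theorem not_isSquare_neg_seven (hℓ : ℓ % 7 = 3 ∨ ℓ % 7 = 5 ∨ ℓ % 7 = 6) :
    ¬ IsSquare ((-7 : ℤ) : ZMod ℓ) := by
  have hℓ2 : ℓ ≠ 2 := by rintro rfl; omega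
  -- decided before the `Fact (Nat.Prime 7)` instance enters the context
  have hℓ7 : ¬ IsSquare ((ℓ : ℤ) : ZMod 7) := by
    rw [Int.cast_natCast, ← ZMod.natCast_mod ℓ 7]
    rcases hℓ with h | h | h <;> rw [h] <;> decide
  haveI : Fact (Nat.Prime 7) := ⟨by norm_num⟩
  rw [← legendreSym.eq_neg_one_iff, legendreSym_neg_seven hℓ2, legendreSym.eq_neg_one_iff]
  exact hℓ7

end Legendre

section Descent

variable {ℓ : ℕ} [hp : Fact ℓ.Prime]

/-- If `-7` is a non-square mod the prime `ℓ`, then `ℓ ∣ a² + 7b²` forces `ℓ ∣ a` and `ℓ ∣ b`. [folklore] -/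
theorem dvd_of_dvd_sq_add_seven_mul_sq (h7 : ¬ IsSquare ((-7 : ℤ) : ZMod ℓ)) {a b : ℤ}
    (h : (ℓ : ℤ) ∣ a ^ 2 + 7 * b ^ 2) : (ℓ : ℤ) ∣ a ∧ (ℓ : ℤ) ∣ b := by
  have hpz : Prime (ℓ : ℤ) := Nat.prime_iff_prime_int.mp hp.out
  have hb : (ℓ : ℤ) ∣ b := by
    by_contra hb
    apply h7
    have hb' : ((b : ℤ) : ZMod ℓ) ≠ 0 := by
      rwa [Ne, ZMod.intCast_zmod_eq_zero_iff_dvd]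
    have h0 : ((a : ℤ) : ZMod ℓ) ^ 2 + 7 * ((b : ℤ) : ZMod ℓ) ^ 2 = 0 := by
      have := (ZMod.intCast_zmod_eq_zero_iff_dvd (a ^ 2 + 7 * b ^ 2) ℓ).2 h
      push_cast at this
      exact this
    refine ⟨((a : ℤ) : ZMod ℓ) / ((b : ℤ) : ZMod ℓ), ?_⟩
    field_simp
    push_cast
    linear_combination -h0
  have h7b : (ℓ : ℤ) ∣ 7 * b ^ 2 := Dvd.dvd.mul_left (dvd_pow hb two_ne_zero) 7
  have ha2 : (ℓ : ℤ) ∣ a ^ 2 := (dvd_add_left h7b).mp h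
  exact ⟨hpz.dvd_of_dvd_pow ha2, hb⟩

/-- **Descent: inert primes are non-norms, with any cofactor prime to them** — `ℓ·m·c² = a² + 7b²` has no
integer solution with `c ≠ 0` when `-7` is a non-square mod `ℓ` and `ℓ ∤ m`. [folklore] -/
theorem not_norm_of_inert (h7 : ¬ IsSquare ((-7 : ℤ) : ZMod ℓ)) {m : ℤ} (hm : ¬ (ℓ : ℤ) ∣ m) :
    ¬ ∃ a b c : ℤ, c ≠ 0 ∧ (ℓ : ℤ) * m * c ^ 2 = a ^ 2 + 7 * b ^ 2 := by
  have hpz : Prime (ℓ : ℤ) := Nat.prime_iff_prime_int.mp hp.out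
  have hℓ0 : (ℓ : ℤ) ≠ 0 := hpz.ne_zero
  have hℓ2 : (2 : ℤ) ≤ ℓ := by exact_mod_cast hp.out.two_le
  suffices H : ∀ n : ℕ, ∀ a b c : ℤ, c.natAbs = n → c ≠ 0 →
      (ℓ : ℤ) * m * c ^ 2 ≠ a ^ 2 + 7 * b ^ 2 by
    rintro ⟨a, b, c, hc, h⟩
    exact H _ a b c rfl hc h
  intro n
  induction n using Nat.strong_induction_on with
  | _ n ih =>
    intro a b c hn hc h
    have hdiv : (ℓ : ℤ) ∣ a ^ 2 + 7 * b ^ 2 := ⟨m * c ^ 2, by rw [← h]; ring⟩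
    obtain ⟨⟨a', rfl⟩, ⟨b', rfl⟩⟩ := dvd_of_dvd_sq_add_seven_mul_sq h7 hdiv
    have h1 : m * c ^ 2 = (ℓ : ℤ) * (a' ^ 2 + 7 * b' ^ 2) := by
      apply mul_left_cancel₀ hℓ0
      linear_combination h
    have hc2 : (ℓ : ℤ) ∣ m * c ^ 2 := ⟨_, h1⟩
    have hcd : (ℓ : ℤ) ∣ c := by
      rcases hpz.dvd_or_dvd hc2 with hmd | hcd
      · exact absurd hmd hm
      · exact hpz.dvd_of_dvd_pow hcd
    obtain ⟨c', rfl⟩ := hcd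
    have hc' : c' ≠ 0 := by rintro rfl; simp at hc
    have h2 : (ℓ : ℤ) * m * c' ^ 2 = a' ^ 2 + 7 * b' ^ 2 := by
      apply mul_left_cancel₀ hℓ0
      linear_combination h1
    have hlt : c'.natAbs < n := by
      rw [← hn, Int.natAbs_mul, Int.natAbs_natCast]
      have hc'pos : 0 < c'.natAbs := Int.natAbs_pos.2 hc'
      have : 1 * c'.natAbs < ℓ * c'.natAbs := Nat.mul_lt_mul_of_pos_right (by omega) hc'pos
      simpa using this
    exact ih _ hlt a' b' c' rfl hc' h2

end Descent

/-- **Infinitely many inert primes** `ℓ ≡ 3 (mod 7)` (Dirichlet, Mathlib). [folklore] -/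
theorem inertPrimes_infinite : {ℓ : ℕ | ℓ.Prime ∧ ℓ % 7 = 3}.Infinite := by
  have h := Nat.infinite_setOf_prime_and_modEq (q := 7) (a := 3) (by norm_num) (by norm_num)
  exact h.mono fun p hp => ⟨hp.1, by simpa [Nat.ModEq] using hp.2⟩

/-- **`ℚ_{>0}/Nm(ℚ(√-7)^×)` is infinite**: an infinite set of non-norms pairwise inequivalent modulo norms —
infinitely many discriminant classes, hence infinitely many `36`-dimensional families of Weil-type abelian
12-folds with `√-7`-multiplication, of which the (7,3) Hecke–Prym anchors meet finitely many.
[cite: vanGeemen1994HodgeAV, 4.14 and Lemma 5.2(3)] -/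
theorem discriminantClasses_infinite :
    ∃ S : Set ℕ, S.Infinite ∧
      (∀ ℓ ∈ S, ¬ ∃ a b c : ℤ, c ≠ 0 ∧ (ℓ : ℤ) * c ^ 2 = a ^ 2 + 7 * b ^ 2) ∧
      ∀ ℓ ∈ S, ∀ ℓ' ∈ S, ℓ ≠ ℓ' →
        ¬ ∃ a b c : ℤ, c ≠ 0 ∧ (ℓ : ℤ) * ℓ' * c ^ 2 = a ^ 2 + 7 * b ^ 2 := by
  refine ⟨{ℓ : ℕ | ℓ.Prime ∧ ℓ % 7 = 3}, inertPrimes_infinite, ?_, ?_⟩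
  · rintro ℓ ⟨hp, h3⟩
    haveI := Fact.mk hp
    have h := not_norm_of_inert (ℓ := ℓ) (not_isSquare_neg_seven (Or.inl h3)) (m := 1)
      (by rw [Int.natCast_dvd_ofNat]; exact hp.one_lt.ne' ∘ Nat.dvd_one.mp)
    simpa using h
  · rintro ℓ ⟨hp, h3⟩ ℓ' ⟨hp', -⟩ hne
    haveI := Fact.mk hp
    exact not_norm_of_inert (ℓ := ℓ) (not_isSquare_neg_seven (Or.inl h3)) (m := ℓ')
      (by rw [Int.natCast_dvd_natCast]
          exact fun hd => hne ((Nat.prime_dvd_prime_iff_eq hp hp').mp hd))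

/-- **`WeilDescending` reaches every class one dimension down**: for `δ < 0` (a class of sign `(-1)^5`, the
12-fold's partner in dimension `10`) and `δ₀ > 0` (the ONE dimension-12 class where the rung is known) there
are positive integers `a, b` with `-ab·δ = t²·δ₀`, `t ≠ 0` — the discriminant `-ab` of `(E × E, aΘ ⊞ bΘ)`
adjusts `det H(A × E × E) = -ab·det H(A)` into the known class (Koike's trick; Markman §1.1). [folklore] -/
theorem descending_reaches_every_class (δ δ₀ : ℚ) (hδ : δ < 0) (hδ₀ : 0 < δ₀) :
    ∃ a b : ℕ, 0 < a ∧ 0 < b ∧ ∃ t : ℚ, t ≠ 0 ∧ -((a * b : ℕ) : ℚ) * δ = t ^ 2 * δ₀ := by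
  set r : ℚ := δ₀ / (-δ) with hr
  have hrpos : 0 < r := div_pos hδ₀ (neg_pos.2 hδ)
  have hnum : 0 < r.num := Rat.num_pos.2 hrpos
  have hden : 0 < r.den := r.den_pos
  refine ⟨r.num.natAbs * r.den, 1, Nat.mul_pos (Int.natAbs_pos.2 hnum.ne') hden, one_pos, r.den,
    by exact_mod_cast hden.ne', ?_⟩
  have hnumcast : ((r.num.natAbs : ℕ) : ℚ) = (r.num : ℚ) := by
    rw [Nat.cast_natAbs, abs_of_pos]; exact_mod_cast hnum
  have hrr : (r.num : ℚ) = r * r.den := by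
    rw [eq_comm]; exact Rat.mul_den_eq_num r
  have hδr : δ₀ = r * (-δ) := by
    rw [hr, div_mul_cancel₀]; exact (neg_pos.2 hδ).ne'
  push_cast
  rw [hnumcast, hrr, hδr]
  ring

/-- Patel–Zhang bookkeeping at rung (7,3): the `ℤ/7`-cover `C̃ → D = C̃/N` has `g(D) = 7` (Riemann–Hurwitz
`2·43 - 2 = 7·(2·7 - 2)`), so `h = 2g(D) - 2 = 12 = 2n` is exactly the degree of the crux's Weil classes and
`dim Prym(C̃/D) = 43 - 7 = 36 = 6·(2·7 - 2)/2`; the pure lines are `|G| - 1 = 6` over ℚ. [folklore] -/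
theorem patelZhang_bookkeeping_7_3 :
    2 * 43 - 2 = 7 * (2 * 7 - 2) ∧ 2 * 7 - 2 = 12 ∧ 43 - 7 = 36 ∧ 36 = 6 * 6 ∧ 7 - 1 = 6 := by decide

/-- The same at rung (7,4) (where item 1261 as stated is actually reached): `g' = 4`, `g(C̃) = 64`
(`2·64 - 2 = 21·6`), `g(D) = 10` (`126 = 7·18`), `h = 18 = 2n` with `n = 3·3 = 9`, `g(C̃/μ₃) = 22`
(`126 = 3·42`), `dim P = 22 - 4 = 18`, Prym locus `3·4 - 3 = 9` inside `n² = 81`. [folklore] -/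
theorem patelZhang_bookkeeping_7_4 :
    2 * 64 - 2 = 21 * (2 * 4 - 2) ∧ 2 * 64 - 2 = 7 * (2 * 10 - 2) ∧ 2 * 10 - 2 = 18 ∧ 3 * (4 - 1) = 9 ∧
      2 * 9 = 18 ∧ 2 * 64 - 2 = 3 * (2 * 22 - 2) ∧ 22 - 4 = 18 ∧ 3 * 4 - 3 = 9 ∧ 9 ^ 2 = 81 := by
  decide

end DiscriminantClasses



/-! ## §11 TARGETS (cycle 4): the stubs of the two registered lines

Payload `targets`/`stuck_stubs` are still empty (no line PICKED, `lead_cycles = 0`), but two skeletons are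
registered and checked: `Lines/amnesic-secant-sheaves-split-fourteenfolds.lean` (stubs S1–S5:
`stub_hyperbolicFourteenfolds`, `stub_aimingArithmetic`, `stub_hyperbolicPartner`, `stub_hodgeTypeExterior`,
`stub_descent`) and `Lines/isotypic-unimodular-saturation.lean` (stubs `stub_schoenLines`,
`stub_heckePrymWeilPlane`, `stub_productAnchor`, `stub_transport`, `stub_reach`, `stub_descent`).  The
adversary attacked all eleven (cheap arsenal: junk/degenerate instances of every hypothesis structure,
quantifier audit, typing arithmetic, small models).  VERDICT TABLE — no stub is refutable; the open
content of BOTH lines is exactly their C⁺ (amnesic S1 = HWA on hyperbolic ℚ(√-7) 14-folds; isotypic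
`stub_transport` = variational Hodge for Weil classes), both implied by the Hodge conjecture, hence
irrefutable here (André); every other stub is a TRUE statement (published theorem / classical / linear
algebra), of the Lean sizes the planners state.  Details and the formal certificates:

AMNESIC LINE
* S1 `stub_hyperbolicFourteenfolds` — conclusion ⊆ HC ⇒ IRREFUTABLE.  Hypothesis audit: `h` is required
  rational, divisor-supported, `ψ`-compatible, with `Q_h = h¹³ ⌣ (·⌣·)` non-degenerate on `H¹` and a
  hyperbolic frame — but NOT ample.  On a simple general member (`NS_ℚ = ℚ·h₀`) this changes nothing; on
  special members a non-ample hyperbolic `h` may exist where the polarisation is not hyperbolic, so S1 is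
  (harmlessly) STRONGER than "HWA on the polarised hyperbolic component"; Markman's engine deforms POLARISED
  triples — if the intended proof needs `h` ample, the lead should add it (reshape, not a falsity).
  `IsHyperbolicWeilType` itself is faithful (van Geemen 5.2(2)/5.4 dictionary; `n = 0` vacuous only).
* S2 `stub_aimingArithmetic` — TRUE (pure algebra, provable now): `P ⊓ N = ⊥` with `dim P = dim N = n`
  forces `H` non-degenerate of signature `(n,n)` (`n₊ ≥ n`, `n₋ ≥ n`, `n₊ + n₋ + n₀ = 2n`); `H ⊕ ⟨m₁r₁, -m₂r₂⟩`
  has signature `(n+1,n+1)` and `det ≡ (-1)^{n+1}·a m₁m₂r₁r₂` (`det H = (-1)ⁿ a`, `a > 0`); Landherr (rank,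
  signature, `det mod Nm(K^×)` classify; via the trace form + Hasse–Minkowski/Meyer as the stub says) makes it
  hyperbolic iff `a m₁m₂r₁r₂ ∈ Nm(K^×)` — always arrangeable (`m₂ = 1`, `m₁ = ` numerator·denominator of
  `a r₁r₂`).  `n = 0` is fine (choose `m₁r₁ = m₂r₂`).  TIGHTNESS, formal (§11c): the weights cannot be
  dropped — `binaryWeilForm_one_neg_three_anisotropic`: for EVERY admissible `K`, `diag(1,-3)` on `K²` has no
  isotropic `K`-line (`3` inert, landed `not_norm_of_inert`), i.e. the `n = 0`, `r = (1,3)`, `m = (1,1)`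
  instance of the weight-free strengthening is FALSE; a proof must use `det H`, not signatures alone; LITERAL form:
  `not_aimingArithmeticUnitWeights : ¬ AimingArithmeticUnitWeights` on the Lean model `K7 = ℚ⟮i√7⟯ ⊂ ℂ` (which also
  witnesses that the stub's `(K, α, hK)` hypotheses are satisfiable — provers may instantiate S2 there).  The
  definitions behave as intended (`diagWeilForm`: `H(x,x) = E(x,αx) = Σ cᵢ Nm(xᵢ)`; `bilinOrthSum` = `E₁ ⊕ E₂`).
* S3 `stub_hyperbolicPartner` — TRUE classically (`B = E × E`, `E = ℂ/ℤ[(1+√-7)/2]`, `φ_B = (ι,-ι)`;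
  descent pair `b₊ = ω₁∧ω̄₂`, `b₋ = ω̄₁∧ω₂`, `η = b₊ + b₋` rational `(1,1)` hence a divisor class,
  `b± ⌣ η = b₊ ⌣ b₋ ≠ 0`; `h = pr_A^*h_A + pr_B^*(m₁h₁ + m₂h₂)` with `(m₁,m₂)` from S2) — not instantiable
  in the tree (needs a Lean `(A, φ)`), so neither provable nor refutable formally today; no junk `B` helps a
  refuter (the `∃ B` is on the prover's side).
* S4 `stub_hodgeTypeExterior` — TRUE (Künneth is a morphism of Hodge structures).  Degenerate parameters are
  harmless: `hodgePQ k p q = ⊥` unless `p + q = k` (`hodgePQ_eq_bot_of_ne`), so off-diagonal types force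
  `c = 0`/`w = 0` and the conclusion reduces to `Nonempty (HodgeModel (a+b) (A.prod B).X)` — the product Hodge
  model, which is the stub's real Lean content; `A = 0` (the one constructible abelian variety) gives `Hᵏ = 0`,
  `k > 0`.
* S5 `stub_descent` — conclusion ⊆ HC ⇒ irrefutable; its bookkeeping is CERTIFIED (§11b): the four
  `(𝟙+ψ)^*`-eigenvalues `λ₊¹⁴, λ₋¹⁴, λ₊¹²λ₋², λ₋¹²λ₊²` are pairwise distinct (`descent_eigenvalues_distinct`),
  `q(X) = X² - 3735552·X + 4398046511104 ∈ ℤ[X]` (`descent_mixedEigenvalues_sum/prod`: `β + β̄ = 2·8²·Re(1+√-7)¹⁰`,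
  `ββ̄ = 8¹⁴`), `q(λ±¹⁴) ≠ 0` (`descentPoly_ne_zero_at_weil`), `(1+i√7)¹⁴ = -712704 - 745472·i√7`.

ISOTYPIC LINE
* `stub_schoenLines` — a published theorem instance (Patel–Zhang Thm 1.2 = Schoen 1988, cyclic étale degree 7,
  `h = 12`), TRUE.  TYPING CERTIFIED (§11a): `twoAddZeta7_prod_eq_pow_iff` — on `⊗_b ⋀^{k_b}H¹(B)_{ψ^b}`,
  `Σk_b = 12`, the eigenvalue `∏(2+ζ₇^b)^{k_b}` of `(2·𝟙+s_B)^*` equals `(2+ζ₇^a)^{12}` iff the multi-index is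
  pure (`43 = Φ₇(-2)` splits completely; proof by reduction modulo the six primes `(2+ζ₇^b)`, `ζ₇ ↦ root43 b ∈ 𝔽₄₃`,
  after `minpoly_ℤ ζ₇ = Φ₇`), so the typed eigenspace is EXACTLY the Schoen line `⋀¹²H¹(B)_{ψ^a}` (given
  `H^* = ⋀^*H¹` and Chevalley–Weil); and `oneAddZeta7_collision`: `(1+ζ)⁵(1+ζ⁶)⁷ = (1+ζ)¹²` — the planner was
  right that `(𝟙+s_B)^*` would NOT separate.  Junk audit of the `∀ (C, 𝒥, σ)` interface: `σ = 𝟙` is excluded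
  by fixed-point-freeness once `C(ℂ) ≠ ∅`; for `C = ∅` the universal property forces `J = 0` (`dim ≠ 43`); a
  disconnected `C` admits NO `Jacobian` structure (constants on a cross component `Dᵢ × Dⱼ` would give a
  divisible subgroup of the f.g. free `Hom(J, E)`), so `𝒥.J.dim = 43` really means `g(C) = 43`.
* `stub_heckePrymWeilPlane` — TRUE given stub 1 (bookkeeping re-derived independently: `σ, τ` fixed-point-free
  ⇒ all of `F₂₁` acts freely, since the 14 elements of order 3 are the conjugates `σ^{-i}τ^{±1}`; `84 = 21·4`;
  `H¹(B) = χ⊗M ⊕ χ̄⊗M̄`, `dim M = 12`, type `(6,6)`; `j^*` = `μ₃`-coinvariants, `e₁ ∉ (t-1)χ`).  Gauss sum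
  CERTIFIED (§11a `gaussSum7_sq`): `(ζ+ζ²+ζ⁴-ζ³-ζ⁵-ζ⁶)² = -7`, so `φ'^{*2} = -7` on `H¹` (sign of `±i√7` per
  `ψ^a` is `(a/7)`, a labelling matter).
* `stub_productAnchor` — TRUE: `f ≫ g = m·𝟙_Y`, `m > 0`, `dim Y = dim (X × B')` force `f` (finite kernel ⊆ Y[m])
  and hence `g` to be isogenies; `g^*` intertwines; Künneth eigen-typing by landed `mixed_eq_plus_iff`; off Weil
  types `(6,6)`/`(1,1)` the "Weil plane algebraic" hypotheses are false (a non-`(p,p)` line), so no junk `X`.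
* `stub_transport` — conclusion ⊆ HC (variational Hodge for Weil classes) ⇒ IRREFUTABLE; = instance of
  `AnchorTransport.VariationalHodge` (proved in the skeleton).  This is the line's whole open content.
* `stub_reach` — classically TRUE (≈ two pages) with two points the prover must not skip: the Weil line is
  monodromy-TRIVIAL only at neat level (`det_K γ ∈ μ(K) = {±1}`, `= 1` for level `≥ 3`), and the global class on
  the OPEN total space comes from Deligne's partie fixe on a smooth compactification; lattice transport puts
  `A × B` and a `Y ~ P' × B'` in one connected `𝓗_{7,δ}` (Landherr + `-m₁m₂δ_P` exhausting classes,
  `descending_reaches_every_class`-style arithmetic); `SU(7,7)` connected.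
* `stub_descent` (isotypic) — as amnesic S4+S5; conclusion ⊆ HC; bookkeeping certified (§11b).

UPSHOT for lead/planner: both skeletons are SOUND and their glue is closed; all risk sits in the two C⁺ stubs,
which no cheap attack can touch (motivated classes).  The adversary's standing recommendation is unchanged from
§10: whichever C⁺ is attempted, its first computable obstruction is a DIMENSION COUNT of first-order deformations
(`36 - 6 = 30` missing directions at a Hecke–Prym; `42 = n(n-1)` obstruction budget for the amnesic monad).
-/

section TargetsCycle4

/-! ### §11a The `(2·𝟙 + s_B)^*` typing device of `stub_schoenLines` / `stub_heckePrymWeilPlane` -/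

section SchoenTyping

open Polynomial

/-- `ζ₇ = exp(2πi/7)`, spelled exactly as in `stub_schoenLines`. -/
abbrev ζ7 : ℂ := Complex.exp (2 * (Real.pi : ℂ) * Complex.I / 7)

/-- `ζ₇` is a primitive 7th root of unity. [folklore] -/
theorem ζ7_isPrimitiveRoot : IsPrimitiveRoot ζ7 7 := by
  have h := Complex.isPrimitiveRoot_exp 7 (by norm_num)
  simpa using h

/-- `ζ₇⁷ = 1`. [folklore] -/
theorem ζ7_pow_seven : ζ7 ^ 7 = 1 := ζ7_isPrimitiveRoot.pow_eq_one

/-- `ζ₇ ≠ 1`. [folklore] -/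
theorem ζ7_ne_one : ζ7 ≠ 1 := ζ7_isPrimitiveRoot.ne_one (by norm_num)

/-- `Φ₇(ζ₇) = 0`. [folklore] -/
theorem ζ7_cyclotomic : 1 + ζ7 + ζ7 ^ 2 + ζ7 ^ 3 + ζ7 ^ 4 + ζ7 ^ 5 + ζ7 ^ 6 = 0 := by
  have h := ζ7_isPrimitiveRoot.geom_sum_eq_zero (by norm_num : 1 < 7)
  simpa [Finset.sum_range_succ] using h

/-- **Refuted alternative typing: `(𝟙 + s_B)^*` does NOT separate the Schoen lines** (the planner's remark,
now checked): `1 + ζ̄ = ζ̄ (1 + ζ)`, so e.g. the mixed multi-index `(5, 0,0,0,0, 7)` collides with the pure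
one: `(1+ζ)^5 (1+ζ^6)^7 = (1+ζ)^12`. [folklore] -/
theorem oneAddZeta7_collision : (1 + ζ7) ^ 5 * (1 + ζ7 ^ 6) ^ 7 = (1 + ζ7) ^ 12 := by
  have h7 := ζ7_pow_seven
  have h6 : 1 + ζ7 ^ 6 = ζ7 ^ 6 * (1 + ζ7) := by linear_combination -h7
  have h42 : (ζ7 ^ 6) ^ 7 = 1 := by
    rw [← pow_mul, show 6 * 7 = 7 * 6 from rfl, pow_mul, h7, one_pow]
  rw [h6, mul_pow, h42, one_mul]
  ring

/-- **The quadratic Gauss sum** (certifies the scalar part of `φ' ≫ φ' = -7` in `stub_heckePrymWeilPlane`):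
`(ζ + ζ² + ζ⁴ - ζ³ - ζ⁵ - ζ⁶)² = -7`, so `η = s + s² + s⁴ - s³ - s⁵ - s⁶` has `η^{*2} = -7` on every
`ψ^a`-eigenspace of `s^*`, `a ≠ 0` (on `ψ^a` the value is `(a/7)·(ζ+ζ²+ζ⁴-ζ³-ζ⁵-ζ⁶)`).  Certificate:
`g(X)² + 7 = (X⁵ + 2X⁴ - X³ + X - 6)(X⁷ - 1) + Φ₇(X)`. [folklore] -/
theorem gaussSum7_sq : (ζ7 + ζ7 ^ 2 + ζ7 ^ 4 - ζ7 ^ 3 - ζ7 ^ 5 - ζ7 ^ 6) ^ 2 = -7 := by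
  have h7 : ζ7 ^ 7 = 1 := ζ7_pow_seven
  have hΦ := ζ7_cyclotomic
  linear_combination (ζ7 ^ 5 + 2 * ζ7 ^ 4 - ζ7 ^ 3 + ζ7 - 6) * h7 + hΦ

/-- If an integer polynomial vanishes at `ζ₇` then `Φ₇` divides it (`minpoly_ℤ ζ₇ = Φ₇`, `ℤ` integrally
closed), so it vanishes at every root of `Φ₇` modulo `43`. [folklore] -/
theorem eval_zmod43_eq_zero_of_aeval_ζ7 (F : ℤ[X]) (hF : aeval ζ7 F = 0) (r : ZMod 43)
    (hr : (cyclotomic 7 (ZMod 43)).eval r = 0) :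
    (F.map (Int.castRingHom (ZMod 43))).eval r = 0 := by
  have hint : IsIntegral ℤ ζ7 := ζ7_isPrimitiveRoot.isIntegral (by norm_num)
  have hmin : cyclotomic 7 ℤ = minpoly ℤ ζ7 := cyclotomic_eq_minpoly ζ7_isPrimitiveRoot (by norm_num)
  have hdvd : cyclotomic 7 ℤ ∣ F := hmin ▸ minpoly.isIntegrallyClosed_dvd hint hF
  have hdvd' : cyclotomic 7 (ZMod 43) ∣ F.map (Int.castRingHom (ZMod 43)) := by
    have h := Polynomial.map_dvd (Int.castRingHom (ZMod 43)) hdvd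
    rwa [map_cyclotomic] at h
  exact eval_eq_zero_of_dvd_of_eval_eq_zero hdvd' hr

/-- For each `a ∈ {1,…,6}` the reduction `r_a ∈ 𝔽₄₃` of `ζ₇` modulo the prime `(2 + ζ₇^a)` over
`43 = Φ₇(-2)`: a root of `Φ₇` with `2 + r_a^a = 0`. [folklore] -/
def root43 (a : ℕ) : ZMod 43 :=
  if a = 1 then 41 else if a = 2 then 16 else if a = 3 then 11 else if a = 4 then 4
  else if a = 5 then 35 else 21

/-- `Φ₇` over `𝔽₄₃`, evaluated. [folklore] -/
theorem cyclotomic7_zmod43_eval (r : ZMod 43) :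
    (cyclotomic 7 (ZMod 43)).eval r = 1 + r + r ^ 2 + r ^ 3 + r ^ 4 + r ^ 5 + r ^ 6 := by
  haveI : Fact (Nat.Prime 7) := ⟨by norm_num⟩
  rw [cyclotomic_prime, eval_finsetSum]
  simp only [eval_pow, eval_X, Finset.sum_range_succ, Finset.sum_range_zero]
  ring

/-- The six primes over `43` are distinct: `r_a` is a root of `Φ₇`, kills `2 + X^a`, and does NOT kill
`2 + X^b` for `b ≠ a` (kernel `decide`). [folklore] -/
theorem root43_spec : ∀ a ∈ Finset.Icc 1 6,
    (cyclotomic 7 (ZMod 43)).eval (root43 a) = 0 ∧ (2 : ZMod 43) + root43 a ^ a = 0 ∧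
      ∀ b ∈ Finset.Icc 1 6, b ≠ a → (2 : ZMod 43) + root43 a ^ b ≠ 0 := by
  simp only [cyclotomic7_zmod43_eval]
  decide

/-- **Typing certificate for `stub_schoenLines`.** On `⊗_b ⋀^{k_b} H¹(B)_{ψ^b}` (`Σ k_b = 12`) the operator
`(2·𝟙_B + s_B)^*` has eigenvalue `∏_b (2 + ζ₇^b)^{k_b}`; it equals `(2 + ζ₇^a)^{12}` iff the multi-index is
PURE (`k_b = 0` for `b ≠ a`).  Reason: `N(2+ζ₇) = Φ₇(-2) = 43` is a prime `≡ 1 (7)`, so the six conjugates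
`2 + ζ₇^b` generate six DISTINCT degree-one primes of `ℤ[ζ₇]`; formally, reduce modulo `(2+ζ₇^b)`
(`ζ₇ ↦ root43 b`), which kills the product and not `(2+ζ₇^a)^{12}` when `k_b ≠ 0`, `b ≠ a`.  Hence
`Eig((2·𝟙+s_B)^*, (2+ζ₇^a)^12) = ⋀¹²H¹(B)_{ψ^a}` exactly — the Schoen line — given `H^* = ⋀^*H¹` and the
Chevalley–Weil dimensions: stub 1 is honestly typed (neither larger nor smaller than Patel–Zhang's summand).
[folklore] -/
theorem twoAddZeta7_prod_eq_pow_iff (a : ℕ) (ha : a ∈ Finset.Icc 1 6) (k : ℕ → ℕ)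
    (hk : ∑ b ∈ Finset.Icc 1 6, k b = 12) :
    ∏ b ∈ Finset.Icc 1 6, (2 + ζ7 ^ b) ^ k b = (2 + ζ7 ^ a) ^ 12 ↔
      ∀ b ∈ Finset.Icc 1 6, b ≠ a → k b = 0 := by
  constructor
  · intro h
    by_contra hne
    push Not at hne
    obtain ⟨b, hb, hba, hkb⟩ := hne
    set F : ℤ[X] := ∏ b ∈ Finset.Icc 1 6, (2 + X ^ b) ^ k b - (2 + X ^ a) ^ 12 with hFdef
    have hF : aeval ζ7 F = 0 := by
      simp only [hFdef, map_sub, map_prod, map_pow, map_add, aeval_X, map_ofNat]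
      rw [h, sub_self]
    obtain ⟨hr, hrb, hrother⟩ := root43_spec b hb
    have h0 := eval_zmod43_eq_zero_of_aeval_ζ7 F hF (root43 b) hr
    have hev : (F.map (Int.castRingHom (ZMod 43))).eval (root43 b) =
        -((2 : ZMod 43) + root43 b ^ a) ^ 12 := by
      simp only [hFdef, Polynomial.map_sub, Polynomial.map_prod, Polynomial.map_pow,
        Polynomial.map_add, Polynomial.map_X, Polynomial.map_ofNat, eval_sub, eval_prod, eval_pow,
        eval_add, eval_X, eval_ofNat]
      rw [Finset.prod_eq_zero hb (by rw [hrb, zero_pow hkb]), zero_sub]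
    rw [hev, neg_eq_zero] at h0
    haveI : Fact (Nat.Prime 43) := ⟨by norm_num⟩
    exact hrother a ha (Ne.symm hba) ((pow_eq_zero_iff (by norm_num)).1 h0)
  · intro h
    have hka : k a = 12 := by
      rw [Finset.sum_eq_single_of_mem a ha (fun b hb hba => h b hb hba)] at hk
      exact hk
    rw [Finset.prod_eq_single_of_mem a ha (fun b hb hba => by rw [h b hb hba, pow_zero]), hka]

end SchoenTyping

/-! ### §11b The descent polynomial of `stub_descent` (both lines): exact integer constants -/

section DescentConstants

/-- `λ₊ λ₋ = (1+i√7)(1-i√7) = 8`. [folklore] -/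
theorem lam_mul_lamBar : (1 + I * s7) * (1 - I * s7) = 8 := by
  have h : (1 + I * s7) * (1 - I * s7) = 1 - (I * s7) * (I * s7) := by ring
  rw [h, Is7_mul_Is7]
  push_cast
  ring

/-- `(1+√-7)^10 = 29184 - 5632 √-7`. [folklore] -/
theorem ω_pow_ten : ω ^ 10 = ⟨29184, -5632⟩ := by decide

/-- `(1+√-7)^14 = -712704 - 745472 √-7`. [folklore] -/
theorem ω_pow_fourteen : ω ^ 14 = ⟨-712704, -745472⟩ := by decide

/-- The Weil eigenvalue one Witt step up: `(1+i√7)^14 = -712704 - 745472·i√7`. [folklore] -/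
theorem weilEigenvalue_fourteen :
    (1 + I * s7) ^ 14 = (-712704 : ℂ) + (-745472 : ℂ) * (I * s7) := by
  rw [emb_ω_pow, ω_pow_fourteen]
  push_cast
  ring

/-- **The descent polynomial has integer coefficients, I**: with `β = λ₊¹²λ₋²`, `β̄ = λ₋¹²λ₊²`,
`β + β̄ = 8²·2·Re(1+√-7)^10 = 3735552`. [folklore] -/
theorem descent_mixedEigenvalues_sum :
    (1 + I * s7) ^ 12 * (1 - I * s7) ^ 2 + (1 - I * s7) ^ 12 * (1 + I * s7) ^ 2 = 3735552 := by
  have h1 : (1 + I * s7) ^ 12 * (1 - I * s7) ^ 2 =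
      ((1 + I * s7) * (1 - I * s7)) ^ 2 * (1 + I * s7) ^ 10 := by ring
  have h2 : (1 - I * s7) ^ 12 * (1 + I * s7) ^ 2 =
      ((1 + I * s7) * (1 - I * s7)) ^ 2 * (1 - I * s7) ^ 10 := by ring
  rw [h1, h2, lam_mul_lamBar, emb_ω_pow 10, embBar_ω_pow 10, ω_pow_ten]
  push_cast
  ring

/-- **… II**: `β β̄ = 8¹⁴ = 4398046511104`; so `q(X) = (X-β)(X-β̄) = X² - 3735552·X + 4398046511104 ∈ ℤ[X]`
(the planner's "`q ∈ ℤ[X]`", with the numbers). [folklore] -/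
theorem descent_mixedEigenvalues_prod :
    ((1 + I * s7) ^ 12 * (1 - I * s7) ^ 2) * ((1 - I * s7) ^ 12 * (1 + I * s7) ^ 2) =
      4398046511104 := by
  have h : ((1 + I * s7) ^ 12 * (1 - I * s7) ^ 2) * ((1 - I * s7) ^ 12 * (1 + I * s7) ^ 2) =
      ((1 + I * s7) * (1 - I * s7)) ^ 14 := by ring
  rw [h, lam_mul_lamBar]
  norm_num

/-- **The four `(𝟙+ψ)^*`-eigenvalues on `pr_A^*(c₊+c₋) ⌣ pr_B^*(b₊+b₋)` are pairwise distinct**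
(`λ₊¹⁴, λ₋¹⁴, λ₊¹²λ₋², λ₋¹²λ₊²`): a coincidence would force `λ₊ⁿ = λ₋ⁿ` for some `n ∈ {2,10,12,14}`
(`weilEigenvalue_pow_ne`).  So `q(T)`, `T = (𝟙+ψ)^*`, kills exactly the two mixed pieces. [folklore] -/
theorem descent_eigenvalues_distinct :
    (1 + I * s7) ^ 14 ≠ (1 - I * s7) ^ 14 ∧
    (1 + I * s7) ^ 14 ≠ (1 + I * s7) ^ 12 * (1 - I * s7) ^ 2 ∧
    (1 + I * s7) ^ 14 ≠ (1 - I * s7) ^ 12 * (1 + I * s7) ^ 2 ∧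
    (1 - I * s7) ^ 14 ≠ (1 + I * s7) ^ 12 * (1 - I * s7) ^ 2 ∧
    (1 - I * s7) ^ 14 ≠ (1 - I * s7) ^ 12 * (1 + I * s7) ^ 2 ∧
    (1 + I * s7) ^ 12 * (1 - I * s7) ^ 2 ≠ (1 - I * s7) ^ 12 * (1 + I * s7) ^ 2 := by
  have hp : (1 + I * s7) ≠ 0 := one_add_Is7_ne_zero
  have hm : (1 - I * s7) ≠ 0 := one_sub_Is7_ne_zero
  refine ⟨weilEigenvalue_pow_ne 14 (by norm_num), ?_, ?_, ?_, ?_, ?_⟩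
  · intro h
    apply weilEigenvalue_pow_ne 2 (by norm_num)
    have h' : (1 + I * s7) ^ 12 * (1 + I * s7) ^ 2 = (1 + I * s7) ^ 12 * (1 - I * s7) ^ 2 := by
      rw [← pow_add]; exact h
    exact mul_left_cancel₀ (pow_ne_zero 12 hp) h'
  · intro h
    apply weilEigenvalue_pow_ne 12 (by norm_num)
    have h' : (1 + I * s7) ^ 12 * (1 + I * s7) ^ 2 = (1 - I * s7) ^ 12 * (1 + I * s7) ^ 2 := by
      rw [← pow_add]; exact h
    exact mul_right_cancel₀ (pow_ne_zero 2 hp) h'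
  · intro h
    apply weilEigenvalue_pow_ne 12 (by norm_num)
    have h' : (1 - I * s7) ^ 12 * (1 - I * s7) ^ 2 = (1 + I * s7) ^ 12 * (1 - I * s7) ^ 2 := by
      rw [← pow_add]; exact h
    exact (mul_right_cancel₀ (pow_ne_zero 2 hm) h').symm
  · intro h
    apply weilEigenvalue_pow_ne 2 (by norm_num)
    have h' : (1 - I * s7) ^ 12 * (1 - I * s7) ^ 2 = (1 - I * s7) ^ 12 * (1 + I * s7) ^ 2 := by
      rw [← pow_add]; exact h
    exact (mul_left_cancel₀ (pow_ne_zero 12 hm) h').symm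
  · intro h
    apply weilEigenvalue_pow_ne 10 (by norm_num)
    have h' : ((1 + I * s7) * (1 - I * s7)) ^ 2 * (1 + I * s7) ^ 10 =
        ((1 + I * s7) * (1 - I * s7)) ^ 2 * (1 - I * s7) ^ 10 := by
      have e1 : (1 + I * s7) ^ 12 * (1 - I * s7) ^ 2 =
          ((1 + I * s7) * (1 - I * s7)) ^ 2 * (1 + I * s7) ^ 10 := by ring
      have e2 : (1 - I * s7) ^ 12 * (1 + I * s7) ^ 2 =
          ((1 + I * s7) * (1 - I * s7)) ^ 2 * (1 - I * s7) ^ 10 := by ring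
      rw [← e1, ← e2]; exact h
    exact mul_left_cancel₀ (pow_ne_zero 2 (mul_ne_zero hp hm)) h'

/-- `q(λ₊¹⁴) ≠ 0 ≠ q(λ₋¹⁴)`: the descent polynomial does not kill the two Weil pieces. [folklore] -/
theorem descentPoly_ne_zero_at_weil :
    ((1 + I * s7) ^ 14 - (1 + I * s7) ^ 12 * (1 - I * s7) ^ 2) *
        ((1 + I * s7) ^ 14 - (1 - I * s7) ^ 12 * (1 + I * s7) ^ 2) ≠ 0 ∧
    ((1 - I * s7) ^ 14 - (1 + I * s7) ^ 12 * (1 - I * s7) ^ 2) *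
        ((1 - I * s7) ^ 14 - (1 - I * s7) ^ 12 * (1 + I * s7) ^ 2) ≠ 0 := by
  obtain ⟨-, h2, h3, h4, h5, -⟩ := descent_eigenvalues_distinct
  exact ⟨mul_ne_zero (sub_ne_zero.2 h2) (sub_ne_zero.2 h3),
    mul_ne_zero (sub_ne_zero.2 h4) (sub_ne_zero.2 h5)⟩

end DescentConstants

/-! ### §11c Tightness of `stub_aimingArithmetic`: the weights `(m₁, m₂)` cannot be dropped -/

section AimingTightness

open Literature.AlgebraicGeometry.Motives

/-- **`3` is not a norm from `ℚ(√-7)`, rational form**: `3c² = A² + 7B²` has no rational solution with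
`c ≠ 0` (clear denominators; `not_norm_of_inert` at the inert prime `ℓ = 3`). [folklore] -/
theorem three_mul_sq_ne_norm (A B c : ℚ) (hc : c ≠ 0) : 3 * c ^ 2 ≠ A ^ 2 + 7 * B ^ 2 := by
  intro h
  haveI : Fact (Nat.Prime 3) := ⟨by norm_num⟩
  have h3 : ¬ IsSquare ((-7 : ℤ) : ZMod 3) := not_isSquare_neg_seven (Or.inl rfl)
  refine not_norm_of_inert (ℓ := 3) h3 (m := 1) (by norm_num)
    ⟨A.num * B.den * c.den, B.num * A.den * c.den, c.num * A.den * B.den, ?_, ?_⟩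
  · exact mul_ne_zero (mul_ne_zero (Rat.num_ne_zero.2 hc) (Nat.cast_ne_zero.2 A.den_nz))
      (Nat.cast_ne_zero.2 B.den_nz)
  · have hA : (A.num : ℚ) = A * A.den := (Rat.mul_den_eq_num A).symm
    have hB : (B.num : ℚ) = B * B.den := (Rat.mul_den_eq_num B).symm
    have hcq : (c.num : ℚ) = c * c.den := (Rat.mul_den_eq_num c).symm
    have key : ((3 : ℚ) * 1 * ((c.num : ℚ) * A.den * B.den) ^ 2) =
        ((A.num : ℚ) * B.den * c.den) ^ 2 + 7 * ((B.num : ℚ) * A.den * c.den) ^ 2 := by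
      rw [hA, hB, hcq]
      linear_combination ((A.den : ℚ) * B.den * c.den) ^ 2 * h
    exact_mod_cast key

/-- Brahmagupta for the norm form of `ℚ(√-7)`: `Nm(x₀) = 3·Nm(x₁)` over `ℚ` forces `x₀ = x₁ = 0`
(`(r₀²+7i₀²)(r₁²+7i₁²) = (r₀r₁+7i₀i₁)² + 7(r₀i₁-i₀r₁)²` and `three_mul_sq_ne_norm`). [folklore] -/
theorem norm_eq_three_mul_norm (r₀ i₀ r₁ i₁ : ℚ)
    (h : r₀ ^ 2 + 7 * i₀ ^ 2 = 3 * (r₁ ^ 2 + 7 * i₁ ^ 2)) :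
    r₀ = 0 ∧ i₀ = 0 ∧ r₁ = 0 ∧ i₁ = 0 := by
  by_cases hN : r₁ ^ 2 + 7 * i₁ ^ 2 = 0
  · have hr₁ : r₁ = 0 := by nlinarith [sq_nonneg r₁, sq_nonneg i₁]
    have hi₁ : i₁ = 0 := by nlinarith [sq_nonneg r₁, sq_nonneg i₁]
    rw [hN, mul_zero] at h
    have hr₀ : r₀ = 0 := by nlinarith [sq_nonneg r₀, sq_nonneg i₀]
    have hi₀ : i₀ = 0 := by nlinarith [sq_nonneg r₀, sq_nonneg i₀]
    exact ⟨hr₀, hi₀, hr₁, hi₁⟩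
  · exfalso
    refine three_mul_sq_ne_norm (r₀ * r₁ + 7 * i₀ * i₁) (r₀ * i₁ - i₀ * r₁) (r₁ ^ 2 + 7 * i₁ ^ 2) hN ?_
    linear_combination -(r₁ ^ 2 + 7 * i₁ ^ 2) * h

variable (K : Type) [Field K] [Algebra ℚ K] (α : K) (hα : α * α = algebraMap ℚ K (-7))
  (hK : ∀ k : K, ∃ a b : ℚ, k = algebraMap ℚ K a + algebraMap ℚ K b * α)

/-- **The weights in `stub_aimingArithmetic` are necessary** (refuted strengthening, for EVERY admissible
`K ≅ ℚ(√-7)` — no `K` needs constructing): the binary Weil form with Hermitian Gram matrix `diag(1, -3)` on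
`K²` (the stub's summand `Im⟨m₁r₁, -m₂r₂⟩` at `r = (1, 3)` with UNIT weights) has NO isotropic `K`-line:
`H(x,x) = E(x, αx) = Nm(x₀) - 3·Nm(x₁)` and `3 ∉ Nm(ℚ(√-7)^×)`.  Hence the `n = 0` instance of the stub
with `m₁ = m₂ = 1` forced is false; the `∃ m₁ m₂` is essential and a proof must go through `det H mod
Nm(K^×)` (Landherr), not through signatures alone.  Serves the verbatim twin stub of the crux-1260 line too.
[folklore] -/
theorem binaryWeilForm_one_neg_three_anisotropic :
    ¬ ∃ L : Submodule K (Fin 2 → K), Module.finrank K L = 1 ∧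
        ∀ x ∈ L, ∀ y ∈ L,
          diagWeilForm (d := 7) (by norm_num) hα hK (Pi.basisFun K (Fin 2)) ![(1 : ℚ), -3] x y = 0 := by
  rintro ⟨L, hL, hiso⟩
  obtain ⟨x, hxL, hx0⟩ : ∃ x ∈ L, x ≠ 0 := by
    by_contra h
    push Not at h
    have hbot : L = ⊥ := (Submodule.eq_bot_iff L).2 h
    rw [hbot, finrank_bot] at hL
    exact zero_ne_one hL
  have h := hiso x hxL (α • x) (L.smul_mem α hxL)
  rw [diagWeilForm_apply] at h
  simp only [Fin.sum_univ_two, coord_alpha_smul, reCoord_alpha_mul, imCoord_alpha_mul,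
    Matrix.cons_val_zero, Matrix.cons_val_one] at h
  set r₀ := reCoord (d := 7) (by norm_num) hα hK ((Pi.basisFun K (Fin 2)).coord 0 x) with hr₀
  set i₀ := imCoord (d := 7) (by norm_num) hα hK ((Pi.basisFun K (Fin 2)).coord 0 x) with hi₀
  set r₁ := reCoord (d := 7) (by norm_num) hα hK ((Pi.basisFun K (Fin 2)).coord 1 x) with hr₁
  set i₁ := imCoord (d := 7) (by norm_num) hα hK ((Pi.basisFun K (Fin 2)).coord 1 x) with hi₁
  have hnorm : r₀ ^ 2 + 7 * i₀ ^ 2 = 3 * (r₁ ^ 2 + 7 * i₁ ^ 2) := by linear_combination h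
  obtain ⟨e₀, f₀, e₁, f₁⟩ := norm_eq_three_mul_norm r₀ i₀ r₁ i₁ hnorm
  apply hx0
  have hcoord : ∀ j : Fin 2, x j = (Pi.basisFun K (Fin 2)).coord j x := fun j => by
    rw [Module.Basis.coord_apply, Pi.basisFun_repr]
  funext j
  rw [Pi.zero_apply, hcoord j,
    eq_reCoord_add_imCoord (d := 7) (by norm_num) hα hK ((Pi.basisFun K (Fin 2)).coord j x)]
  fin_cases j
  · simp only [Fin.zero_eta]
    rw [← hr₀, ← hi₀, e₀, f₀, map_zero, zero_mul, add_zero]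
  · simp only [Fin.mk_one]
    rw [← hr₁, ← hi₁, e₁, f₁, map_zero, zero_mul, add_zero]

end AimingTightness

section UnitWeightsModel

open Polynomial IntermediateField Literature.AlgebraicGeometry.Motives


/-! #### A Lean MODEL of `K = ℚ(√-7)`: the subfield `ℚ⟮i√7⟯ ⊂ ℂ` (non-vacuity witness for the
`(K, α, hα, hK)` interface of `stub_aimingArithmetic`, `Motives.diagWeilForm`, `Motives.weilDiscriminant`) -/

/-- `i√7 ∈ ℂ`. [folklore] -/
abbrev isqrt7 : ℂ := I * ((Real.sqrt (7 : ℝ) : ℝ) : ℂ)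

theorem isqrt7_mul_self : isqrt7 * isqrt7 = -7 := by
  have h : isqrt7 * isqrt7 = (I * I) * (((Real.sqrt (7 : ℝ) : ℝ) : ℂ) * ((Real.sqrt (7 : ℝ) : ℝ) : ℂ)) := by
    simp only [isqrt7]; ring
  rw [h, I_mul_I, ← Complex.ofReal_mul, Real.mul_self_sqrt (by norm_num : (0 : ℝ) ≤ 7)]
  push_cast; ring

/-- The minimal polynomial `X² + 7` of `i√7`, monic of degree 2. [folklore] -/
abbrev P7 : ℚ[X] := X ^ 2 + C (7 : ℚ)

theorem P7_monic : P7.Monic :=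
  (monic_X_pow 2).add_of_left (by
    rw [degree_C (by norm_num : (7:ℚ) ≠ 0), degree_X_pow]; norm_num)

theorem P7_degree : P7.degree = 2 := by
  rw [P7, degree_add_eq_left_of_degree_lt]
  · rw [degree_X_pow]; rfl
  · rw [degree_X_pow, degree_C (by norm_num : (7:ℚ) ≠ 0)]; norm_num

theorem aeval_isqrt7_P7 : aeval isqrt7 P7 = 0 := by
  simp only [map_add, map_pow, aeval_X, aeval_C, eq_ratCast]
  rw [sq, isqrt7_mul_self]
  push_cast; ring

theorem isqrt7_isIntegral : IsIntegral ℚ isqrt7 :=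
  ⟨P7, P7_monic, by rw [← aeval_def]; exact aeval_isqrt7_P7⟩

/-- `K = ℚ(i√7) ⊂ ℂ` as an intermediate field (a `Field` with `Algebra ℚ`). [folklore] -/
abbrev K7 : IntermediateField ℚ ℂ := ℚ⟮isqrt7⟯

theorem coe_algebraMap_K7 (x : ℚ) : ((algebraMap ℚ K7 x : K7) : ℂ) = (x : ℂ) := by
  rw [← eq_ratCast (algebraMap ℚ ℂ)]
  rfl

/-- `α = i√7 ∈ K`. [folklore] -/
def α7 : K7 := ⟨isqrt7, mem_adjoin_simple_self ℚ isqrt7⟩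

theorem coe_α7 : ((α7 : K7) : ℂ) = isqrt7 := rfl

theorem α7_mul_self : α7 * α7 = algebraMap ℚ K7 (-7) := by
  apply Subtype.ext
  rw [IntermediateField.coe_mul, coe_algebraMap_K7, coe_α7, isqrt7_mul_self]
  push_cast
  rfl

/-- Every element of `ℚ⟮i√7⟯` is `a + b·i√7` with `a, b ∈ ℚ` (reduce a representing polynomial modulo `X² + 7`). [folklore] -/
theorem K7_span : ∀ k : K7, ∃ a b : ℚ, k = algebraMap ℚ K7 a + algebraMap ℚ K7 b * α7 := by
  intro k
  have hk : (k : ℂ) ∈ (ℚ⟮isqrt7⟯ : IntermediateField ℚ ℂ).toSubalgebra := k.2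
  rw [adjoin_simple_toSubalgebra_of_isAlgebraic isqrt7_isIntegral.isAlgebraic,
    Algebra.adjoin_singleton_eq_range_aeval] at hk
  obtain ⟨p, hp⟩ := hk
  have hmod : aeval isqrt7 (p %ₘ P7) = aeval isqrt7 p :=
    aeval_modByMonic_eq_self_of_root aeval_isqrt7_P7
  have hdeg : (p %ₘ P7).degree ≤ 1 := by
    have h2 : (p %ₘ P7).degree < P7.degree := degree_modByMonic_lt p P7_monic
    rw [P7_degree] at h2
    exact Order.le_of_lt_succ h2
  have hform := eq_X_add_C_of_degree_le_one hdeg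
  set c0 := (p %ₘ P7).coeff 0 with hc0
  set c1 := (p %ₘ P7).coeff 1 with hc1
  refine ⟨c0, c1, Subtype.ext ?_⟩
  rw [IntermediateField.coe_add, IntermediateField.coe_mul, coe_algebraMap_K7, coe_algebraMap_K7, coe_α7]
  change aeval isqrt7 p = _ at hp
  rw [← hp, ← hmod, hform]
  simp only [map_add, map_mul, aeval_C, aeval_X, eq_ratCast]
  ring


/-- **The unit-weight strengthening of `stub_aimingArithmetic`** (its `∃ m₁ m₂` replaced by
`m₁ = m₂ = 1`; everything else verbatim). FALSE: `not_aimingArithmeticUnitWeights`. [folklore] -/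
def AimingArithmeticUnitWeights : Prop :=
    ∀ (K : Type) [Field K] [Algebra ℚ K] (α : K) (hα : α * α = algebraMap ℚ K (-7))
      (hK : ∀ k : K, ∃ a b : ℚ, k = algebraMap ℚ K a + algebraMap ℚ K b * α)
      (V : Type) [AddCommGroup V] [Module ℚ V] [Module K V] [IsScalarTower ℚ K V]
      [Module.Finite K V] (n : ℕ), Module.finrank K V = 2 * n →
    ∀ (E : LinearMap.BilinForm ℚ V), (∀ x y : V, E x y = -E y x) →
      (∀ x y : V, E (α • x) (α • y) = 7 * E x y) →
      (∃ P N : Submodule K V, Module.finrank K P = n ∧ Module.finrank K N = n ∧ P ⊓ N = ⊥ ∧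
        (∀ x ∈ P, x ≠ 0 → 0 < E x (α • x)) ∧ (∀ x ∈ N, x ≠ 0 → E x (α • x) < 0)) →
    ∀ r₁ r₂ : ℚ, 0 < r₁ * r₂ →
        ∃ L : Submodule K (V × (Fin 2 → K)), Module.finrank K L = n + 1 ∧
          ∀ x ∈ L, ∀ y ∈ L,
            bilinOrthSum E
              (diagWeilForm (d := 7) (by norm_num) hα hK (Pi.basisFun K (Fin 2))
                ![r₁, -r₂]) x y = 0

/-- **Refuted strengthening of `stub_aimingArithmetic`: unit weights do not suffice.**  Witness: the model
`K = ℚ⟮i√7⟯ ⊂ ℂ`, `V = 0` (`n = 0`), `E = 0`, `P = N = ⊥`, `(r₁, r₂) = (1, 3)`: the strengthening would give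
an isotropic `K`-line of `diag(1, -3)` on `K²`, contradicting `binaryWeilForm_one_neg_three_anisotropic`. [folklore] -/
theorem not_aimingArithmeticUnitWeights : ¬ AimingArithmeticUnitWeights := by
  intro h
  have hV : Module.finrank K7 (Fin 0 → K7) = 2 * 0 := by simp
  obtain ⟨L, hL, hiso⟩ := h K7 α7 α7_mul_self K7_span (Fin 0 → K7) 0 hV 0
    (fun x y => by simp) (fun x y => by simp)
    ⟨⊥, ⊥, by simp, by simp, by simp, fun x hx hx0 => absurd ((Submodule.mem_bot K7).1 hx) hx0,
      fun x hx hx0 => absurd ((Submodule.mem_bot K7).1 hx) hx0⟩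
    1 3 (by norm_num)
  have hinj : Function.Injective (LinearMap.snd K7 (Fin 0 → K7) (Fin 2 → K7)) := by
    intro x y hxy
    exact Prod.ext (Subsingleton.elim _ _) hxy
  refine binaryWeilForm_one_neg_three_anisotropic K7 α7 α7_mul_self K7_span
    ⟨L.map (LinearMap.snd K7 (Fin 0 → K7) (Fin 2 → K7)), ?_, ?_⟩
  · rw [← LinearEquiv.finrank_eq (Submodule.equivMapOfInjective _ hinj L), hL]
  · rintro _ ⟨x, hx, rfl⟩ _ ⟨y, hy, rfl⟩
    have h0 := hiso x hx y hy
    rw [bilinOrthSum_apply, LinearMap.zero_apply, LinearMap.zero_apply, zero_add] at h0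
    exact h0

end UnitWeightsModel

/-! ### §11d CHEAPEST FALSIFIER OF THE AMNESIC MECHANISM, RUN (moment-system part): the card's rank-2
theta-monad does not exist; the theta-realizable secant classes on a ppav 7-fold have rank ∈ 45ℤ

The idea card `Ideas/amnesic-secant-sheaves-split-fourteenfolds.md` (intended proof of S1
`stub_hyperbolicFourteenfolds`) bets on "ONE amnesic `G`-equivariant simple THETA-MONAD
`0 → ⊕𝒪(m₁Θ)^{a₁} → ⋯ → ⊕𝒪(m₈Θ)^{a₈} → 0` on a ppav 7-fold with `ch ∈ P_α`", and displays the candidate: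
"rank 2 with `c(F) = 1 + Θ + 2Θ²` has Chern roots `αΘ, ᾱΘ`, `α = (1+√-7)/2`, hence `ch = e^{αΘ} + e^{ᾱΘ} ∈ P_α`
… the smallest possible moments `(2, 1, -3, -5, 1, 11, 9, -13)` … ANY ≥ 8 INTEGRAL SLOPES SOLVE THE MOMENT SYSTEM BY
VANDERMONDE".  Vandermonde solves it over `ℚ`, not over `ℤ`.  A complex of direct sums of theta-powers has
`ch = Σ_m n_m e^{mθ}` with INTEGER net multiplicities `n_m`, i.e. moments `M_i = Σ_m n_m mⁱ` (`i ≤ g`,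
`θ^{g+1} = 0`); such `M` is realizable iff its binomial moments `B_k = Σ_m n_m C(m,k)`, `k ≤ g`, are integers,
and for the secant class `c·e^{αθ} + c̄·e^{ᾱθ}` (`c ∈ K`) this reads `Tr_{K/ℚ}(c·C(α,k)) ∈ ℤ` for `k ≤ g`.
Now `C(α,4) = α(α-1)(α-2)(α-3)/24 = (α-1)/3` has trace `-1/3`: for `c = 1` and every `g ≥ 4`,
`B₄ = (M₄ - 6M₃ + 11M₂ - 6M₁)/24 = (1 + 30 - 33 - 6)/24 = -1/3 ∉ ℤ` — kernel-checked below as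
`no_thetaComplex_with_unit_secant_moments` (`24 ∣ m(m-1)(m-2)(m-3)`).  So the displayed rank-2 instance is not
the Chern character of ANY finite complex of direct sums of theta-powers on any ppav of dimension `≥ 4` (in
Markman's dimension 3 the condition stops at `k = 3` and holds: `Tr C(α,k) = 2, 1, -2, 1`).  The full lattice
(reproducible rational arithmetic, evidence `theta_moments.py/.out` attached to the item): `Tr C(α,k)` for
`k = 0..7` is `2, 1, -2, 1, -1/3, 0, 7/45, -2/9`; the theta-realizable rational points of `P_α` on a ppav
`g`-fold are `c·e^{αθ} + c̄·e^{ᾱθ}` with `c` in a lattice `Λ_g`, and the RANKS `Tr c` they allow are: `g = 3`: all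
of `ℤ`; `g = 4, 5`: `3ℤ`; `g = 6, 7`: `45ℤ`; for `g = 7` exactly `Λ₇ = 45·ℤ[α]` (index `45²`).  The rank statements
are KERNEL-CHECKED: `thetaComplex_secant_rank_dvd_fortyfive` (`45 ∣ M₀` from the moments up to `6` and the secant
recurrence: `120·B₅ = 16M₀ - 32M₁`, `720·B₆ = 144M₁ - 16M₀`), `thetaComplex_secant_rank_dvd_three` (dim `≥ 4`).  Smallest
realizations on a ppav 7-fold: `c = 45α` (rank 45), slopes `-3,…,3`, net multiplicities
`(-4, 42, -210, 560, -420, 84, -7)` (a 7-term complex `𝒪(-3Θ)⁴ → 𝒪(-2Θ)⁴² → 𝒪(-Θ)²¹⁰ → 𝒪⁵⁶⁰ → 𝒪(Θ)⁴²⁰ →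
𝒪(2Θ)⁸⁴ → 𝒪(3Θ)⁷` has the right class; `Σ|n_m| = 1327`); `c = 45` (rank 90), slopes `-3,…,4`,
`(-4, 35, -126, 140, 140, -126, 35, -4)`.  CONSEQUENCES for the line (not for the crux, which stays HC-implied):
(i) the card's "rank-2 / low-rank candidates (`c = 1 + Θ + 2Θ²`, Bogomolov `Δ = 7Θ²`)" are gone: an honest
theta-monad `F` has `|rank| ≥ 45` and hundreds of line-bundle summands, so the budget "`F` SIMPLE with
`dim Ext²(F,F)^G = 42 = n(n-1)` exactly" must be met by an object whose `E₁`-page (`Hom(𝒪(mΘ)^a, 𝒪(m'Θ)^b) =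
ab·(m'-m)⁷` in one degree, Mumford) has, for the rank-45 complex, total dimension `542985` in degree `0`,
`12036759` in degree `1`, `81426555` in degree `2` (computed; Euler characteristic `0`) — and `χ(F,F) = ∫ch(F^∨)ch(F) = 0` for
every secant class (the cross terms `e^{±√-7θ}` integrate to `(√-7)⁷ + (-√-7)⁷ = 0`), so no Euler-characteristic
shortcut bounds `Ext²`; (ii) alternatively the object must leave the theta-lattice (e.g. a `μ_r`-TWISTED sheaf,
`45 ∣ r`-type denominators — which the card allows only on Markman's `Y = (X×X̂)/Ḡ` side, not for `F`), or use
classes outside `ℤ[e^{mθ}]` (Abel–Jacobi / `W_k` classes — exactly the curve-built objects the card's (F1) forbids);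
(iii) the line file's statement of S1 ("`ch(F) ∈ P_α`", no normalization) survives with `c ∈ 45ℤ[α]`; its
"cheapest falsifier (triage, unrun): enumerate `≤ 8`-slope theta-monads solving the `P_α` moment system" now has
its first answer: no solution below rank 45; the `Ext²` enumeration should start from the two complexes above.
-/

section AmnesicMoments

/-- `24 ∣ m(m-1)(m-2)(m-3) = m⁴ - 6m³ + 11m² - 6m` for every integer `m` (`= 24·C(m,4)`). [folklore] -/
theorem twentyfour_dvd_fallingFactorial_four (m : ℤ) : (24 : ℤ) ∣ m ^ 4 - 6 * m ^ 3 + 11 * m ^ 2 - 6 * m := by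
  have h : ∀ x : ZMod 24, x ^ 4 - 6 * x ^ 3 + 11 * x ^ 2 - 6 * x = 0 := by decide
  have h' : ((m ^ 4 - 6 * m ^ 3 + 11 * m ^ 2 - 6 * m : ℤ) : ZMod 24) = 0 := by
    push_cast
    exact h m
  exact_mod_cast (ZMod.intCast_zmod_eq_zero_iff_dvd _ 24).1 h'

/-- **No theta-complex has the unit secant moments** (refutes the amnesic card's displayed rank-2 instance).
If integers `n_m` (net multiplicity of `𝒪(mΘ)` in a finite complex of direct sums of theta-powers on a ppav of
dimension `≥ 4`, `ch = Σ_m n_m e^{mθ}`) had the moments `Σ n_m m = 1`, `Σ n_m m² = -3`, `Σ n_m m³ = -5`,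
`Σ n_m m⁴ = 1` of the class `e^{αθ} + e^{ᾱθ}`, `α = (1+√-7)/2` (the card's `(2, 1, -3, -5, 1, 11, 9, -13)`),
then `Σ_m n_m·m(m-1)(m-2)(m-3) = 1 + 30 - 33 - 6 = -8`, but every term is divisible by `24`.  Equivalently
`Tr C(α,4) = -1/3 ∉ ℤ`.  Valid for any finite slope set `s`, any number of slopes. [folklore] -/
theorem no_thetaComplex_with_unit_secant_moments (s : Finset ℤ) (n : ℤ → ℤ)
    (h1 : ∑ m ∈ s, n m * m = 1) (h2 : ∑ m ∈ s, n m * m ^ 2 = -3)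
    (h3 : ∑ m ∈ s, n m * m ^ 3 = -5) (h4 : ∑ m ∈ s, n m * m ^ 4 = 1) : False := by
  have key : ∑ m ∈ s, n m * (m ^ 4 - 6 * m ^ 3 + 11 * m ^ 2 - 6 * m) = -8 := by
    have hsplit : ∑ m ∈ s, n m * (m ^ 4 - 6 * m ^ 3 + 11 * m ^ 2 - 6 * m) =
        (∑ m ∈ s, n m * m ^ 4) - 6 * (∑ m ∈ s, n m * m ^ 3) + 11 * (∑ m ∈ s, n m * m ^ 2) -
          6 * (∑ m ∈ s, n m * m) := by
      rw [Finset.mul_sum, Finset.mul_sum, Finset.mul_sum, ← Finset.sum_sub_distrib,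
        ← Finset.sum_add_distrib, ← Finset.sum_sub_distrib]
      exact Finset.sum_congr rfl fun m _ => by ring
    rw [hsplit, h1, h2, h3, h4]
    norm_num
  have hdvd : (24 : ℤ) ∣ ∑ m ∈ s, n m * (m ^ 4 - 6 * m ^ 3 + 11 * m ^ 2 - 6 * m) :=
    Finset.dvd_sum fun m _ => Dvd.dvd.mul_left (twentyfour_dvd_fallingFactorial_four m) _
  rw [key] at hdvd
  omega

/-- The smallest theta-realizable secant class on a ppav 7-fold, `c = 45α` (rank `45`): the net multiplicities
`(-4, 42, -210, 560, -420, 84, -7)` over the slopes `-3, …, 3` have EXACTLY the moments `Tr(45·α^{i+1})`,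
`i = 0..7`, namely `(45, -135, -225, 45, 495, 405, -585, -1395)` (kernel arithmetic; the corrected starting point
for the card's `Ext²` enumeration). [folklore] -/
theorem thetaComplex_rank45_moments :
    (let n : ℤ → ℤ := fun m => if m = -3 then -4 else if m = -2 then 42 else if m = -1 then -210
      else if m = 0 then 560 else if m = 1 then -420 else if m = 2 then 84 else if m = 3 then -7 else 0
    let s : List ℤ := [-3, -2, -1, 0, 1, 2, 3]
    (List.map (fun i : ℕ => (s.map fun m => n m * m ^ i).sum) (List.range 8))) =
      [45, -135, -225, 45, 495, 405, -585, -1395] := by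
  decide

/-- … and these ARE the moments of `45α·e^{αθ} + 45ᾱ·e^{ᾱθ}`: with `ω = 1 + √-7 = 2α`,
`Tr(45 α^{i+1}) = 45·Re(ω^{i+1})/2^{i}`; checked through `2^{i}·M_i = 45·2·re(ω^{i+1})/2 = 45·re(ω^{i+1})`
for `i = 0..7` in `ℤ[√-7]`. [folklore] -/
theorem rank45_moments_are_secant :
    (List.map (fun i : ℕ => (45 : ℤ) * ((⟨1, 1⟩ : ℤ√(-7)) ^ (i + 1)).re) (List.range 8)) =
      (List.map (fun p : ℤ × ℕ => p.1 * 2 ^ p.2)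
        [((45 : ℤ), 0), (-135, 1), (-225, 2), (45, 3), (495, 4), (405, 5), (-585, 6), (-1395, 7)]) := by
  decide

set_option maxRecDepth 100000 in
/-- `120 ∣ m(m-1)(m-2)(m-3)(m-4)` (`= 120·C(m,5)`). [folklore] -/
theorem fallingFactorial_five_dvd (m : ℤ) :
    (120 : ℤ) ∣ m ^ 5 - 10 * m ^ 4 + 35 * m ^ 3 - 50 * m ^ 2 + 24 * m := by
  have h : ∀ x : ZMod 120, x ^ 5 - 10 * x ^ 4 + 35 * x ^ 3 - 50 * x ^ 2 + 24 * x = 0 := by decide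
  have h' : ((m ^ 5 - 10 * m ^ 4 + 35 * m ^ 3 - 50 * m ^ 2 + 24 * m : ℤ) : ZMod 120) = 0 := by
    push_cast
    exact h m
  exact_mod_cast (ZMod.intCast_zmod_eq_zero_iff_dvd _ 120).1 h'

set_option maxRecDepth 200000 in
/-- `720 ∣ m(m-1)⋯(m-5)` (`= 720·C(m,6)`). [folklore] -/
theorem fallingFactorial_six_dvd (m : ℤ) :
    (720 : ℤ) ∣ m ^ 6 - 15 * m ^ 5 + 85 * m ^ 4 - 225 * m ^ 3 + 274 * m ^ 2 - 120 * m := by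
  have h : ∀ x : ZMod 720, x ^ 6 - 15 * x ^ 5 + 85 * x ^ 4 - 225 * x ^ 3 + 274 * x ^ 2 - 120 * x = 0 := by
    decide
  have h' : ((m ^ 6 - 15 * m ^ 5 + 85 * m ^ 4 - 225 * m ^ 3 + 274 * m ^ 2 - 120 * m : ℤ) : ZMod 720) = 0 := by
    push_cast
    exact h m
  exact_mod_cast (ZMod.intCast_zmod_eq_zero_iff_dvd _ 720).1 h'

/-- **Theta-complexes in the secant plane `P_α` have rank divisible by `45`** (ppav of dimension `≥ 6`).
Let `M_i = Σ_m n_m mⁱ` (`i ≤ 6`) be the moments of a finite complex of direct sums of theta-powers, and suppose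
they satisfy the secant recurrence `M_{i+2} = M_{i+1} - 2M_i` (`i ≤ 4`) — i.e. `(M_i)` are the moments
`Tr(c·αⁱ)` of a rational point `c·e^{αθ} + c̄·e^{ᾱθ}` of `P_α`, `α² = α - 2`, `α = (1+√-7)/2`.  Then
`45 ∣ M_0 = rank`.  Proof: the binomial moments `Σ n_m C(m,5)`, `Σ n_m C(m,6)` are integers, and modulo the
recurrence `120·B₅ = 16M₀ - 32M₁`, `720·B₆ = 144M₁ - 16M₀`.  With `thetaComplex_rank45_moments` (rank `45`
attained) this pins the theta-realizable ranks in `P_α` on a ppav 7-fold to `45ℤ` exactly; the card's rank `2`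
is excluded a second time. [folklore] -/
theorem thetaComplex_secant_rank_dvd_fortyfive (s : Finset ℤ) (n : ℤ → ℤ) (M : ℕ → ℤ)
    (hmom : ∀ i, i ≤ 6 → ∑ m ∈ s, n m * m ^ i = M i)
    (hrec : ∀ i, i ≤ 4 → M (i + 2) = M (i + 1) - 2 * M i) : (45 : ℤ) ∣ M 0 := by
  have h5 : (120 : ℤ) ∣ M 5 - 10 * M 4 + 35 * M 3 - 50 * M 2 + 24 * M 1 := by
    have hs : ∑ m ∈ s, n m * (m ^ 5 - 10 * m ^ 4 + 35 * m ^ 3 - 50 * m ^ 2 + 24 * m) =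
        (∑ m ∈ s, n m * m ^ 5) - 10 * (∑ m ∈ s, n m * m ^ 4) + 35 * (∑ m ∈ s, n m * m ^ 3) -
          50 * (∑ m ∈ s, n m * m ^ 2) + 24 * (∑ m ∈ s, n m * m ^ 1) := by
      rw [Finset.mul_sum, Finset.mul_sum, Finset.mul_sum, Finset.mul_sum, ← Finset.sum_sub_distrib,
        ← Finset.sum_add_distrib, ← Finset.sum_sub_distrib, ← Finset.sum_add_distrib]
      exact Finset.sum_congr rfl fun m _ => by ring
    have hd : (120 : ℤ) ∣ ∑ m ∈ s, n m * (m ^ 5 - 10 * m ^ 4 + 35 * m ^ 3 - 50 * m ^ 2 + 24 * m) :=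
      Finset.dvd_sum fun m _ => Dvd.dvd.mul_left (fallingFactorial_five_dvd m) _
    rwa [hs, hmom 5 (by norm_num), hmom 4 (by norm_num), hmom 3 (by norm_num), hmom 2 (by norm_num),
      hmom 1 (by norm_num)] at hd
  have h6 : (720 : ℤ) ∣ M 6 - 15 * M 5 + 85 * M 4 - 225 * M 3 + 274 * M 2 - 120 * M 1 := by
    have hs : ∑ m ∈ s, n m * (m ^ 6 - 15 * m ^ 5 + 85 * m ^ 4 - 225 * m ^ 3 + 274 * m ^ 2 - 120 * m) =
        (∑ m ∈ s, n m * m ^ 6) - 15 * (∑ m ∈ s, n m * m ^ 5) + 85 * (∑ m ∈ s, n m * m ^ 4) -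
          225 * (∑ m ∈ s, n m * m ^ 3) + 274 * (∑ m ∈ s, n m * m ^ 2) - 120 * (∑ m ∈ s, n m * m ^ 1) := by
      rw [Finset.mul_sum, Finset.mul_sum, Finset.mul_sum, Finset.mul_sum, Finset.mul_sum,
        ← Finset.sum_sub_distrib, ← Finset.sum_add_distrib, ← Finset.sum_sub_distrib, ← Finset.sum_add_distrib,
        ← Finset.sum_sub_distrib]
      exact Finset.sum_congr rfl fun m _ => by ring
    have hd : (720 : ℤ) ∣ ∑ m ∈ s, n m * (m ^ 6 - 15 * m ^ 5 + 85 * m ^ 4 - 225 * m ^ 3 + 274 * m ^ 2 - 120 * m) :=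
      Finset.dvd_sum fun m _ => Dvd.dvd.mul_left (fallingFactorial_six_dvd m) _
    rwa [hs, hmom 6 (by norm_num), hmom 5 (by norm_num), hmom 4 (by norm_num), hmom 3 (by norm_num),
      hmom 2 (by norm_num), hmom 1 (by norm_num)] at hd
  have r0 := hrec 0 (by norm_num)
  have r1 := hrec 1 (by norm_num)
  have r2 := hrec 2 (by norm_num)
  have r3 := hrec 3 (by norm_num)
  have r4 := hrec 4 (by norm_num)
  simp only [zero_add] at r0
  norm_num at r1 r2 r3 r4
  omega

/-- The same in dimension `≥ 4` (moments up to `4`): `3 ∣ rank`. [folklore] -/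
theorem thetaComplex_secant_rank_dvd_three (s : Finset ℤ) (n : ℤ → ℤ) (M : ℕ → ℤ)
    (hmom : ∀ i, i ≤ 4 → ∑ m ∈ s, n m * m ^ i = M i)
    (hrec : ∀ i, i ≤ 2 → M (i + 2) = M (i + 1) - 2 * M i) : (3 : ℤ) ∣ M 0 := by
  have h3 : (6 : ℤ) ∣ M 3 - 3 * M 2 + 2 * M 1 := by
    have hs : ∑ m ∈ s, n m * (m ^ 3 - 3 * m ^ 2 + 2 * m) =
        (∑ m ∈ s, n m * m ^ 3) - 3 * (∑ m ∈ s, n m * m ^ 2) + 2 * (∑ m ∈ s, n m * m ^ 1) := by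
      rw [Finset.mul_sum, Finset.mul_sum, ← Finset.sum_sub_distrib, ← Finset.sum_add_distrib]
      exact Finset.sum_congr rfl fun m _ => by ring
    have hd : (6 : ℤ) ∣ ∑ m ∈ s, n m * (m ^ 3 - 3 * m ^ 2 + 2 * m) := by
      refine Finset.dvd_sum fun m _ => Dvd.dvd.mul_left ?_ _
      have h : ∀ x : ZMod 6, x ^ 3 - 3 * x ^ 2 + 2 * x = 0 := by decide
      have h' : ((m ^ 3 - 3 * m ^ 2 + 2 * m : ℤ) : ZMod 6) = 0 := by push_cast; exact h m
      exact_mod_cast (ZMod.intCast_zmod_eq_zero_iff_dvd _ 6).1 h'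
    rwa [hs, hmom 3 (by norm_num), hmom 2 (by norm_num), hmom 1 (by norm_num)] at hd
  have h4 : (24 : ℤ) ∣ M 4 - 6 * M 3 + 11 * M 2 - 6 * M 1 := by
    have hs : ∑ m ∈ s, n m * (m ^ 4 - 6 * m ^ 3 + 11 * m ^ 2 - 6 * m) =
        (∑ m ∈ s, n m * m ^ 4) - 6 * (∑ m ∈ s, n m * m ^ 3) + 11 * (∑ m ∈ s, n m * m ^ 2) -
          6 * (∑ m ∈ s, n m * m ^ 1) := by
      rw [Finset.mul_sum, Finset.mul_sum, Finset.mul_sum, ← Finset.sum_sub_distrib,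
        ← Finset.sum_add_distrib, ← Finset.sum_sub_distrib]
      exact Finset.sum_congr rfl fun m _ => by ring
    have hd : (24 : ℤ) ∣ ∑ m ∈ s, n m * (m ^ 4 - 6 * m ^ 3 + 11 * m ^ 2 - 6 * m) := by
      refine Finset.dvd_sum fun m _ => Dvd.dvd.mul_left ?_ _
      have h : ∀ x : ZMod 24, x ^ 4 - 6 * x ^ 3 + 11 * x ^ 2 - 6 * x = 0 := by decide
      have h' : ((m ^ 4 - 6 * m ^ 3 + 11 * m ^ 2 - 6 * m : ℤ) : ZMod 24) = 0 := by push_cast; exact h m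
      exact_mod_cast (ZMod.intCast_zmod_eq_zero_iff_dvd _ 24).1 h'
    rwa [hs, hmom 4 (by norm_num), hmom 3 (by norm_num), hmom 2 (by norm_num), hmom 1 (by norm_num)] at hd
  have r0 := hrec 0 (by norm_num)
  have r1 := hrec 1 (by norm_num)
  have r2 := hrec 2 (by norm_num)
  simp only [zero_add] at r0
  norm_num at r1 r2
  omega


end AmnesicMoments


end TargetsCycle4


end Summit.HodgeConjecture.HodgeConjecture.Cruxes.WeilTwelvefoldsSqrtMinus7.Disproof

end
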